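import Mathlib
import HarnessLib
import HarnessLib.Audit
import Summits.FinalStateConjecture.Statement
import Literature.Geometry.Lorentzian.StationaryFinalStateDecomposition
import HarnessLib.Audit.Status.Attr

/-!
Route: RootDecompAxisymmetricJunction

# Route RootDecompAxisymmetricJunction — Root decomposition N3d «AxisymmetricJunction» (form b″) —
StaticJunction leaves by signature; the non-static no-hair residual 29012 cut by AXISYMMETRY of the
horizon-collar end-state model (ε-free)

DECOMPOSITION CELL decomp-fsc (D-0178; doctrine D-0170/0171/0172), summit S =
`_root_.FinalStateConjecture` exactly as typed; LADDER rung 0 — NOTHING IN THIS FILE PROVES THE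
FINAL STATE CONJECTURE. THIN SIBLING in FILING FORM (b″) = critic FORM RULING R3 (α)
2026-08-30T07:06:59Z (CRITIC-LEDGER row 76; admitted under the tower cap T6 exception (b): the
census count changes with two residuals in DISTINCT barrier/instrument classes plus an attackable
by-name door, and the born glue 29014 closes outright): the seven top-level leaves of
route-FinalStateConjecture-RootDecompStaticJunction with the cut leaf GlobalNoHair 28242 REPLACED by
its three born split children StaticNoHair 29011, NonStaticNoHair 29012, StaticJointExit 29013 —
nine items BY SIGNATURE + Assembly — so that the layer-2 child NonStaticNoHair sits at top level and
can receive the lens-3 g7 cut «AxisymmetricJunction» as a glued split (gate max_depth 1 forbids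
splitting it where it was born). It suffices to show the conjunction X of the nine leaves; `closes`
is the lens's self-contained closes₉ (g7/glue_sketch.lean, rc 0, std axioms):
RootDecompGermJunction's born `key` step «IsTameChristodoulouGeneric Q 1 ⇒ a tame exit for Q through
the failing admissible datum» and the handover C (A-exit) (B₃ (B₁-exit) (NH₃ (NH₁-exit) (S₃
(S₁-exit) (S₂-exit)))) — i.e. GlobalNoHair derived inline from its three children (= the proved glue
29014). Every leaf is S-implied (free exact population split; kernel
pieces_of_finalStateConjecture), so X ⟺ S; the content is the LOCALISATION of the
black-hole-uniqueness residual into typed model classes.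
Lean: `NonStaticNoHair ∧ GenericAsymptoticStationarity ∧ WeakCosmicCensorship ∧ PerturbativeNoHair ∧
StaticNoHair ∧ StaticJointExit ∧ NoHairJointExit ∧ StationaryJointExit ∧ JointExit`

## Assembly
Pure logic inside `closes` (folder/aj/glue.lean = lens-3 g7 glue_sketch closes₉ verbatim, written
against decl names identical to this file's): the `key` step and the handover C X D hD hP (A-exit)
(fun ¬K ↦ B₃ X D hD ¬K (B₁-exit) (fun ¬I ↦ NH₃ X D hD ¬I (NH₁-exit) (fun ¬G ↦ S₃ X D hD ¬G (S₁-exit)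
(S₂-exit)))). The optional Assembly item records the nine-fold implication.

Rationale: WHY THIS LINE. Population splits of the exceptional set are free and exact, hence judged on content
and on the PARK RULE (a cut of a parked residual needs a norm-matched printed rung or changes the
census honestly). Gen 6 (StaticJunction) emptied the STATIC end-state models by the analyticity-free
static uniqueness theorem; gen 7 cuts the remaining NON-STATIC no-hair residual S₂ = Generic(St →
¬StS → ¬StN → K) by the next exact symmetry type of the limit model, AXISYMMETRY, at MODEL level and
ε-free: IsHc (horizon-collar model: IsSt ∧ Kerr–Schild truncation radius ∃ a′ ∧ C^∞ ∧ spacelike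
slices ∧ uniformly stationary far end ∧ strictly trapped open collar) ⊃ IsAc (∧ the axial field J =
x¹∂₂ − x²∂₁ is g₀-Killing in first-order form ∧ Carter orbit-signature clause pinning the event
horizon to {r = ρ_H}). The axisymmetric cell A is a DOOR emptied BY NAME by the tree fact
`ChruscielCostaHeusler2012_axisymmetricUniqueness` (Chruściel–Costa–Heusler Living Reviews 2012 Thm
3.1: I⁺-regular, stationary, axisymmetric, connected non-degenerate horizon, vacuum ⟹ Kerr d.o.c.)
at the open-end StationaryAFBlackHole + IPlusRegularHypersurface structures — instance recipe
accepted by the critic line by line (c11), with ONE flagged sub-lemma (global hyperbolicity of the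
d.o.c. {r > ρ_H} of an arbitrary smooth stationary-axisymmetric vacuum form = port D17), hence
PROVISIONAL not EMPTY; the non-axisymmetric cell E is the NAMED open problem «Hawking rigidity
without analyticity» for dynamically reached non-degenerate rotating end states (Ionescu–Klainerman
2009–13, Alexakis–Ionescu–Klainerman 2010/2014), typed as the honest complement; the collarless cell
F carries the generic third law / extremal stratum and the sub-truncation / non-uniform-far-end
normal-form failures; J is the thin junction. Imported: stationary black-hole uniqueness theory
(Carter–Robinson–CCH, the I⁺-regularity framework) + Reiris' stationary-AF theorem (D7 widened) +
Kerr–Schild model geometry already in the tree (KerrSchildCoord, KerrRadiusGradientVector,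
KerrAxialKillingField); nothing perturbative-about-Kerr, no stability theorem, no tolerance.

RANKED CRUXES. #2 NonStaticNoHair (crux) — = the BORN item stmt-FinalStateConjecture-29012 of
route-FinalStateConjecture-RootDecompStaticJunction (S₂, layer-2 child of GlobalNoHair 28242 via
split #17; home tag NEW RESIDUAL · COUNTS · PARKED), reused BY SIGNATURE (dedup-attach); EXPOSED AT
TOP LEVEL HERE to receive, right after birth, the critic-CLEARED (2026-08-30T07:06:59Z, FORM RULING
R3 (α) under T6 exception (b), CRITIC-LEDGER row 76) lens-3 g7 cut «AxisymmetricJunction» as its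
glued split (k = 4 approved: exact trichotomy + thin junction): AxisymmetricNoHair A (axisymmetric
horizon-collar limit models; DOOR, PROVISIONAL-EMPTY by the tree fact
ChruscielCostaHeusler2012_axisymmetricUniqueness BY NAME modulo ports D17/D18/D7′, does NOT count),
NonAxisymmetricNoHair E (NEW RESIDUAL: rigidity without analyticity; COUNTS), CollarlessNoHair F
(third law / normal form; COUNTS-small), CollarJointExit J (thin junction), glue A → E → F → J →
NonStaticNoHair (kernel closes_nonStatic; exactness node_iff BY NAME). Text as born: NON-STATIC
NO-HAIR: tame-Christodoulou-generically, an admissible datum whose MGHDs settle to boosted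
stationary models (St, born text verbatim) that admit NEITHER a smooth static trapped-collar
presentation (¬ StS: in every admissible presentation some hole's end state rotates — its stationary
… (full text as born on the home route) [difficulty: open-problem] (why it might fail: a tame-open
set of admissible data may settle to a rotating non-Kerr smooth stationary vacuum (rigidity without
analyticity is open away from Kerr: T-trapped null geodesics block unique continuation) or to
extremal Kerr (third law failing openly)) [arXiv:1501.01587, arXiv:1205.6112, arXiv:0806.0016,
arXiv:0904.0982, arXiv:2211.15742, arXiv:2402.10190, arXiv:1206.6598, arXiv:2205.14808,
arXiv:2304.08455]
#3 GenericAsymptoticStationarity (crux) — = the BORN item stmt-FinalStateConjecture-25288 of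
route-FinalStateConjecture-RootDecompGermJunction (B1, node N3; by signature on
RootDecompSequentialJunction / RootDecompStaticJunction, kept WHOLE here), reused BY SIGNATURE
(dedup-attach); text as born: [crux] PIECE B1 of the split of GenericKerrSettling
(stmt-FinalStateConjecture-17274) — GENERIC ASYMPTOTIC STATIONARITY (dynamics wall): for every
admissible carrier X, tame-Christodoulou-generically in admissibleVacuumData X every maximal vacuum
Cauchy development settles, in the Statement's own C² chart currency … (full text as born on the
home route) [difficulty: open-problem] (why it might fail: generic MGHDs need not settle in C² on
exhaustive slabs: never-stationary end phases (perpetual N-body zoom-whirl, slowly decaying hair,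
weak-null-singular exteriors) of positive tame codimension-0 measure are not excluded beyond |a| ≪ M
perturbations of Kerr) [arXiv:1710.01722, arXiv:2104.11857, arXiv:2205.14808, arXiv:0904.0982,
DafermosHolzegelRodnianskiTaylor2021]
#4 WeakCosmicCensorship (crux) — = the BORN item stmt-FinalStateConjecture-17269 of
route-FinalStateConjecture-RootDecompGermJunction / RootDecompSequentialJunction /
RootDecompStaticJunction (A; also TameCensorship on the N5 routes), reused BY SIGNATURE
(dedup-attach); text as born: [crux] (imported; re-typed successor of WeakCosmicCensorshipMGHD after
the statement revision p126844, re-type T2) TAME weak cosmic censorship in MGHD form: for every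
connected Hausdorff second-countable smooth 3-manifold X, tame-Christodoulou-generically in
admissibleVacuumData X (IsTameChristodoulouGeneric … 1: the escaping … (full text as born on the
home route) [difficulty: open-problem] (why it might fail: weak cosmic censorship in the smooth tame
vacuum class is open: Christodoulou's instability theorem is BV scalar-field and does not descend
(barrier Part 6); wDist-stable naked-singularity formation from admissible vacuum data (beyond the
fine-tuned examples of arXiv:2204.09891) is not excluded) [Christodoulou1999, arXiv:2204.09891,
arXiv:2402.00062, arXiv:0811.0354, arXiv:1912.08478]
#5 PerturbativeNoHair (crux) — = the BORN item stmt-FinalStateConjecture-28241 of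
route-FinalStateConjecture-RootDecompSequentialJunction (NH₁, layer-2 child of 25289; by signature
on RootDecompStaticJunction), reused BY SIGNATURE (dedup-attach); text as born: [crux · child NH₁ of
B2 stmt-25289 · WEAKER · ATTACKABLE(porting) · UNDECIDED[effective ε at the typed tuple] · does NOT
count] PERTURBATIVE NO-HAIR: tame-Christodoulou-generically (codim ≥ 1 in admissibleVacuumData X,
tame immersed curves), an admissible datum whose MGHDs settle — in the born C² chart currency of St
VERBATIM … (full text as born on the home route) [difficulty: open-problem] (why it might fail: the
typed tolerance (10⁻⁶ weighted C¹⁰, spin ≤ 0.9M, collar M/4) may exceed the effective smallness of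
every printed rigidity/stability theorem; AIK needs a bifurcate sphere a future-horizon model lacks;
honest Kerr re-charting (exhaustive, future-oriented) is unported) [arXiv:0904.0982,
arXiv:1501.01587, arXiv:2104.11857, arXiv:2205.14808, arXiv:gr-qc/9811021, arXiv:2606.28253,
BeigSimon1980, arXiv:0902.1173]
#6 StaticNoHair (crux) — = the BORN item stmt-FinalStateConjecture-29011 of
route-FinalStateConjecture-RootDecompStaticJunction (S₁, layer-2 child of GlobalNoHair 28242 via
split #17; home tag WEAKER · ATTACKABLE(porting) · rung BY PRINT CCH 2012 Thm 3.1 / CG 2010 Thm 1.1;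
D7 wi-97106 (widened to StationaryLimitEndAF) + D8 wi-97107 = first lemmas), reused BY SIGNATURE
(dedup-attach); text as born: STATIC NO-HAIR: tame-Christodoulou-generically (codim ≥ 1 in
admissibleVacuumData X, tame immersed curves), an admissible datum whose MGHDs settle — in the born
C² chart currency of St VERBATIM (late hole charts on boosted models, late flat chart, O =
exteriorOf, RaysStayInClosure, exhaustive radii Rᵢ → ∞ with floor ρᵢ + 1, … (full text as born on
the home route) [difficulty: open-problem] (why it might fail: porting, not physics — first lemmas:
D7 (AF of the static limit end: delivered by NO born clause) and D8 (print-faithful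
boundary-allowing transcription of static uniqueness, CCH 2012 Thm 3.1); then vacuum-of-limit,
horizon/I⁺ causal theory, EH-normalised ingoing-KS re-charting (unported)) [arXiv:1004.0513,
doi:10.1007/BF00759198, doi:10.1103/PhysRev.164.1776, arXiv:gr-qc/9809088, arXiv:gr-qc/0512116,
arXiv:gr-qc/9311012, arXiv:1002.1172, arXiv:gr-qc/0001003, arXiv:1501.01587]
#9 StaticJointExit (support) — = the BORN item stmt-FinalStateConjecture-29013 of
route-FinalStateConjecture-RootDecompStaticJunction (S₃, layer-2 thin junction of the static cut;
home kind crux 203, local kind support = ∧/→-tax only), reused BY SIGNATURE (dedup-attach); text as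
born: ] STATIC JOINT EXIT (the junction tax of S₁ ∧ S₂ and nothing more): at every admissible datum
D where the global implication St D → ¬StN D → K D fails, a tame exit for the static implication StS
→ ¬StN → K (handed over if it fails at D) and a tame exit for the non-static implication St → ¬StS →
¬StN → K (handed over if it fails … (full text as born on the home route) [difficulty: open-problem]
(why it might fail: at a datum where St → ¬StS → ¬StN → K fails, S₂'s exit carries data that may
settle to a STATIC non-near-Kerr presentation where nothing typed forces K until static uniqueness
is ported; joining needs the door PointwiseStaticNoHair or corner general position)
[arXiv:1004.0513, arXiv:2104.11857, Christodoulou2008BlackHoles]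
#9 NoHairJointExit (support) — = the BORN item stmt-FinalStateConjecture-28243 of
route-FinalStateConjecture-RootDecompSequentialJunction (NH₃; by signature on
RootDecompStaticJunction; home kind crux, local kind support = junction tax), reused BY SIGNATURE
(dedup-attach); text as born: [crux · child NH₃ of B2 stmt-25289 · WEAKER · thin · ∧/→-tax ·
UNDECIDED[doors]] NO-HAIR JOINT EXIT (the junction tax of NH₁ ∧ NH₂ and nothing more): at every
admissible datum D where the no-hair implication St D → K D fails, a tame exit for the perturbative
implication StN → K (handed over if it fails at D) and a tame exit for … (full text as born on the
home route) [difficulty: open-problem] (why it might fail: at a datum where StN → K fails, NH₁'s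
exit curve carries data on which StN may FAIL while St holds with a far end state, where nothing
forces K; joining needs tame openness of slow-near-Kerr settling (asymptotic stability of Kerr along
tame curves) or corner general position) [arXiv:2104.11857, arXiv:2205.14808,
Christodoulou2008BlackHoles]
#9 StationaryJointExit (support) — = the BORN item stmt-FinalStateConjecture-25290 of
route-FinalStateConjecture-RootDecompGermJunction (B3; home kind crux, local kind support = junction
tax), reused BY SIGNATURE (dedup-attach); text as born: [crux] PIECE B3 — STATIONARY JOINT EXIT (the
∧/→-tax of B1 ∧ B2 and nothing more): at every admissible datum D not settling to sub-extremal Kerr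
(¬K D), a tame exit for stationary settling St (handed over if St fails at D) and a tame exit for
the no-hair implication St → K (handed over if it fails at D) yield ONE tame exit (one … (full text
as born on the home route) [difficulty: open-problem] (why it might fail: at a datum where St holds
but St → K fails, B2's exit curve carries data where St may FAIL (St is not tame-open), so K need
not hold along it; joining needs tame openness of stationary settling or corner general position)
[arXiv:2104.11857, arXiv:2205.14808, Christodoulou2008BlackHoles]
#9 JointExit (support) — = the BORN item stmt-FinalStateConjecture-24565 of
route-FinalStateConjecture-RootDecompGermJunction (C; home kind crux, local kind support = junction
tax), reused BY SIGNATURE (dedup-attach); text as born: [crux] PIECE C — JointExit [WEAKER·thin —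
critic CLEARED 2026-08-30T01:37:00Z: «the ∧-tax isolated as a piece; S ⟹ JointExit kernel
(jointExit_of_finalStateConjecture)»; UNDECIDED[doors all open at large data; stated test/rungs: r1
TameStableSettles at Kerr-close base data (KS21/GKS22 port), r2 CornerExit under an explicit … (full
text as born on the home route) [difficulty: open-problem] (why it might fail: off the corner it
needs the good clause to persist along the other clause's exit (asymptotic stability of settling /
censoredness along tame curves at LARGE data, open); at a corner datum it needs a third exit; false
for general predicate pairs (TameGenericityAndFails).) [arXiv:2104.08222, arXiv:2104.11857,
Christodoulou1999]

TWO-LAYER PLAN. Layer 2 here = {AxisymmetricNoHair A (support · DOOR · PROVISIONAL-EMPTY BY TREE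
FACT BY NAME modulo ports D17 AxiCollarIPlusRegular + D18 TrappedCollarNonDegenerate + D7′
StationaryLimitEndAF (wi-97106 widened) + kernel lemmas L_Y / P1a / P6 · ATTACKABLE(porting) · does
NOT count), NonAxisymmetricNoHair E (crux · NEW RESIDUAL of S₂ · COUNTS · inside
IonescuKlainermanNonExtension as typed · IDEA-NEEDED · PARKED), CollarlessNoHair F (crux ·
COUNTS-small · third law / normal form · INSTRUMENTABLE), CollarJointExit J (crux · thin ∧/→-tax ·
UNDECIDED)} under NonStaticNoHair, filed as the glued split right after birth with glue
'AxisymmetricNoHair → NonAxisymmetricNoHair → CollarlessNoHair → CollarJointExit → NonStaticNoHair'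
(k = 4 approved; texts = lens-3 g7 children.json VERBATIM; no new item imports — FilingProbe rc 0
under the host header); the new glue item is provable now (kernel
Filing.nonStaticNoHairGlue_selfcontained). Foreseen, NOT filed (β-rule): the ∀-data door
PointwiseAxisymmetricNoHair ⟹ A (not S-implied ⇒ never an item). TOWER CAP T6: this is the lens-3
tower's depth-3 host (GermJunction → SequentialJunction → StaticJunction → this), admitted under
exception (b) as sharpened by the critic («the new counting residuals must sit in distinct
instrument/barrier classes»); gen-8 cuts on this lineage are HOME-only unless T6 (a)/(b)/(c) applies
again.

KILL CRITERIA. All nine binders and all four split children are S-implied in the lens kernel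
(pieces_of_finalStateConjecture), so a refutation of any of them refutes S as typed: a tame-open set
of admissible data settling (born C² chart currency) to a smooth stationary AXISYMMETRIC
horizon-collar vacuum end state that is not a Kerr exterior after re-charting kills A (and
contradicts CCH 2012 Thm 3.1 unless the flagged global-hyperbolicity sub-lemma fails — which is
exactly what D17 decides); a tame-open family settling to a smooth stationary NON-axisymmetric
trapped-collar vacuum black hole kills E (rigidity without analyticity false in the large); an open
set settling to extremal Kerr or to stationary ends with no smooth Kerr–Schild-radius normal form
kills F (generic third law false); a datum where only A's exit is available and its curve re-enters
E/F-type limits off 0 kills J as typed (junction needs the door or corner general position). Retire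
`superseded` if a rigidity-without-analyticity theorem for all sub-extremal stationary vacuum black
holes appears in print (E then empties by porting).

NOT DECOMPOSED YET. NonAxisymmetricNoHair's interior (Hawking rigidity without analyticity away from
Kerr; coaxial multi-horizon equilibria; the fast range) and CollarlessNoHair's strata (extremal /
near-extremal settling = third law; sub-truncation horizons; non-uniformly-stationary far ends) are
deliberately NOT items (T6; no certified instrument yet — F is INSTRUMENTABLE via near-extremal
settling tails, handed to the census); A's porting spine (D17, D18, L_Y, D7′, P1a, P6 + the by-name
fact) is typer/line work, not route items; the ∀-data door PointwiseAxisymmetricNoHair is never an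
item (β-rule).

CHEAPEST FALSIFIER. A / D17: is the domain of outer communications {r > ρ_H} of an ARBITRARY smooth
stationary axisymmetric vacuum form satisfying clauses (i)–(viii) (Kerr–Schild truncation radius,
uniformly stationary far end, strictly trapped open collar, Carter orbit-signature clause) globally
hyperbolic with an I⁺-regular Cauchy hypersurface? This is the one hypothesis of CCH 2012 Thm 3.1
not implied by the typed clauses (critic-flagged); a counterexample form (e.g. a stationary
axisymmetric vacuum metric with closed timelike curves outside {r = ρ_H} yet a trapped collar below)
would turn the door A from PROVISIONAL-EMPTY into a genuine residual and is a finite symbolic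
computation on candidate Weyl–Papapetrou forms. Second: the kernel's anti-vacuity witness (rotating
Kerr collar 0 < |a| < M is IsAc, isAxiCollarModel_kerrCollar) already rules out the vacuous reading.

NUMBERS. Ledger signatures reused byte-equal: 17269 (562 chars), 25288 (3034), 28241 (4314), 29011
(7807), 29012 (9691), 29013 (10350), 28243 (6807), 25290 (4185), 24565 (4272); children one-liners A
8211 / E 8242 / F 7347 / J 9081 chars (all < 12000; == g7/children.json statements == kernel Filing
defs, md5/10 2f9bd1b1dc / a479a7b86d / d6a4ea3540 / 0e27c4185c). No tolerance, no Kerr parameter and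
no rate is typed in any piece: the model clauses (i)–(viii) are first order in g₀ with ∃ a′, ∃ c >
0, ∃ ρ_H (critic c4 ✓); anti-vacuity by a ROTATING Kerr collar 0 < |a| < M (c6 ✓, no [Kerr.Facts]).

DEFINITION REQUESTS. Per the critic's ruling R3 (iv) (D9 is taken by the K–N Bondi ledger wi-97120,
so lens-3's requests are renumbered): D17 «port: AxiCollarIPlusRegular» (est. M–L; I⁺-regularity of
the d.o.c. {r > ρ_H} of an axisymmetric horizon-collar model incl. the FLAGGED global-hyperbolicity
sub-lemma; --for the A item once born), D18 «port: TrappedCollarNonDegenerate» (est. M; a strictly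
trapped open collar below a Killing horizon forces non-zero surface gravity; --for A), D7 wi-97106
WIDENED / re-titled «port: StationaryLimitEndAF» (Reiris arXiv:1310.0339 Thm 1 / Cor 1: stationary
vacuum ends with uniformly timelike Killing field are AF — serves StaticNoHair 29011 AND A; one
port, two consumers, approved; recorded by an evidence note on wi-97106); L_Y (axial Killing field
of the limit ⇒ axisymmetric black-hole structure), P1a, P6 (EH-normalised re-charting) stay
kernel-or-shared lemmas, no request.

Novelty: GEN-7 on 29012 (lens-3 g7 2026-08-30T07:04:22Z + critic CLEARED / R3 2026-08-30T07:06:59Z + writer):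
the move = cut the non-static no-hair residual by the next EXACT SYMMETRY TYPE of the nonlinear
limit model — axisymmetry — stated at MODEL level as first-order ε-free clauses (horizon-collar
normal form + axial Killing field in Lie-derivative form + Carter orbit-signature clause), so that
the axisymmetric side is emptied BY NAME by the tree's Chruściel–Costa–Heusler 2012 uniqueness fact
(modulo one flagged causal sub-lemma) and the census residual becomes the NAMED problem «rigidity
without analyticity» plus a third-law cell. Searches RUN (lens-3 g7 NODE §2/§5, labelled): `lean
search ChruscielCostaHeusler2012` → Literature fact ChruscielCostaHeusler2012_axisymmetricUniqueness
(StationaryBlackHoleUniqueness) [tree]; corpus `lit search --hybrid "stationary axisymmetric vacuum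
black hole uniqueness Kerr I+ regular"` → [corpus:arXiv:1205.6112 §3 Thm 3.1],
[corpus:arXiv:0806.0016] (Chruściel–Costa), [corpus:book:heuslernd-black-hole-uniqueness-theorems];
`lit vsearch "rigidity of stationary black holes without analyticity"` → arXiv:0902.1173,
arXiv:0904.0982, arXiv:1501.01587 §4 (open away from Kerr); galaxy `lit galaxy search
"Carter-Robinson|orbit space|I+-regular" --star all` → [galaxy:pdf] Weinstein / Neugebauer–Hennig
multi-horizon papers (coaxial equilibria excluded only with extra hypotheses). Nearest prior art:
route-FinalStateConjecture-RootDecompStaticJunction (gen 6, s  [refs: 1205.6112, 0806.0016, 0902.1173, 0904.0982, 1501.01587, book:heuslernd-black-hole-uniqueness-theorems, ChruscielCostaHeusler2012]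

Barriers (technique_class: population-split, limit-model axisymmetry, CCH rung): - technique_class: population-split, limit-model axisymmetry, CCH rung
- Literature.Barriers.FinalStateConjecture.IonescuKlainermanNonExtension: the residual E
(NonAxisymmetricNoHair) sits INSIDE this barrier's technique class AS TYPED and says so — closing E
head-on would need Hawking rigidity without analyticity away from Kerr, where unique continuation
across the ergoregion fails on T-trapped null geodesics (Ionescu–Klainerman); E is therefore
declared a PARKED named-problem residual, not attacked; the door A is OUTSIDE the class: CCH 2012
Thm 3.1 ASSUMES the axial Killing field (clause (vii)), so no Killing extension / unique
continuation is constructed; F and J construct none either.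
- Literature.Barriers.FinalStateConjecture.AretakisInstabilityNarrow: extremal horizons are excluded
from A and E by the strictly trapped OPEN collar (non-degenerate surface gravity, port D18) and
collected in F as a third-law statement about DATA (generic non-extremality of the end state), where
the Aretakis instability of exactly extremal horizons is the reason F is COUNTS-small and
instrumentable rather than empty; no uniform-in-spin horizon estimate is used.
- Literature.Barriers.FinalStateConjecture.SlowlyRotatingKerrFrontier: no stability theorem is
invoked by the cut: the end state in A is identified by UNIQUENESS (CCH 2012), not by evolution, for
ALL sub-extremal spins at once (the kernel's witness is a rotating Kerr collar 0 < |a| < M); the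
frontier is a positive near-Kerr theorem a

sub-problem: FinalStateConjecture · status: draft · opened planner-decomp-fsc-writer-1-g2-0 2026-08-30T07:15:17Z · rev 1 · ledger route-FinalStateConjecture-RootDecompAxisymmetricJunction
GENERATED by the gate from the ledger (D-0016/17). Provers cite these decls: `theorem foo : Summit.FinalStateConjecture.FinalStateConjecture.Theses.RootDecompAxisymmetricJunction.<Decl> := …` in Summits/FinalStateConjecture/FinalStateConjecture/Theorems/<Name>.lean.
-/

namespace Summit.FinalStateConjecture.FinalStateConjecture.Theses.RootDecompAxisymmetricJunction

open scoped BigOperators Topology Manifold Classical MeasureTheory ProbabilityTheory Matrix InnerProductSpace ComplexConjugate ContinuousMap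
open Filter Set Function TopologicalSpace MeasureTheory

attribute [summit_statement] _root_.FinalStateConjecture

/-- item stmt-FinalStateConjecture-29012 · crux · rank 2 · SPLIT (gen 1) into AxisymmetricNoHair, NonAxisymmetricNoHair, CollarlessNoHair, CollarJointExit + glue NonStaticNoHairGlue · direct attempts still welcome (low priority) · by planner
why it might fail: a tame-open set of admissible data may settle to a rotating non-Kerr smooth stationary vacuum (rigidity without analyticity is open away from Kerr: T-trapped null geodesics block unique continuation) or to extremal Kerr (third law failing openly)
sources: arXiv:1501.01587, arXiv:1205.6112, arXiv:0806.0016, arXiv:0904.0982, arXiv:2211.15742, arXiv:2402.10190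
[crux · child S₂ of NH₂ stmt-28242 · WEAKER · COUNTS · NEW RESIDUAL · INTERNAL NODE · IDEA-NEEDED ·
inside IonescuKlainermanNonExtension as typed] NON-STATIC NO-HAIR: tame-Christodoulou-generically,
an admissible datum whose MGHDs settle to boosted stationary models (St, born text verbatim) that
admit NEITHER a smooth static trapped-collar presentation (¬ StS: in every admissible presentation
some hole's end state rotates — its stationary Killing field is not hypersurface-orthogonal across a
trapped collar — or is only C²-rough, degenerate, exterior-only or multi-component inside one chart)
NOR a slow-near-Kerr collar presentation (¬ StN, born) settles to boosted sub-extremal Kerr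
exteriors (K). = NH₂ relieved, BY CONSTRUCTION and ε-free, of every static end state: what remains
is exactly the ROTATING half of black-hole uniqueness for dynamically reached end states — Kerr
uniqueness without analyticity and without smallness (Hawking rigidity needs analyticity,
Chruściel–Costa arXiv:0806.0016; Alexakis–Ionescu–Klainerman only near Kerr; «wide open» IK review
arXiv:1501.01587 §4), fast 0.9M < |a| < M, near-extremal and extremal end states (generic third law:
Kehle–Unger arXiv:2211.15 -/
@[route_item "route-FinalStateConjecture-RootDecompAxisymmetricJunction", crux]
def NonStaticNoHair : Prop :=
  ∀ (X : Type) [TopologicalSpace X] [ChartedSpace Literature.Geometry.Lorentzian.E3 X] [IsManifold (𝓡 3) ((⊤ : ℕ∞) : WithTop ℕ∞) X] [T2Space X] [SecondCountableTopology X] [ConnectedSpace X], let IsSt : Literature.Geometry.Lorentzian.ModelBackground → (Literature.Geometry.Lorentzian.E4 → Literature.Geometry.Lorentzian.E4) → ℝ → Prop := fun B V ρ ↦ (∀ x, B.time x = x 0) ∧ ((B.domain : Set Literature.Geometry.Lorentzian.E4) = {x | ρ < B.radius x}) ∧ (∀ (t : ℝ) (y : Literature.Geometry.Lorentzian.E3),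 B.radius (Literature.Geometry.Lorentzian.E4.ofTimeSpace t y) = B.radius (Literature.Geometry.Lorentzian.E4.ofTimeSpace 0 y)) ∧ (∀ (t : ℝ) (y : Literature.Geometry.Lorentzian.E3), B.bilin (Literature.Geometry.Lorentzian.E4.ofTimeSpace t y) = B.bilin (Literature.Geometry.Lorentzian.E4.ofTimeSpace 0 y)) ∧ (∀ (t : ℝ) (y : Literature.Geometry.Lorentzian.E3), V (Literature.Geometry.Lorentzian.E4.ofTimeSpace t y) = V (Literature.Geometry.Lorentzian.E4.ofTimeSpace 0 y)) ∧ ∀ x ∈ B.domain, B.bilin x (V x) (V x) < 0 ∧ 0 < V x 0; let IsNr : Literature.Geometry.Lorentzian.ModelBackground → (Literature.Geometry.Lorentzian.E4 → Literature.Geometry.Lorentzian.E4) → ℝ → Prop := fun B V ρ ↦ IsSt B V ρ ∧ ContDiffOn ℝ ((⊤ : ℕ∞) : WithTop ℕ∞) B.bilin (B.domain : Set Literature.Geometry.Lorentzian.E4) ∧ ∃ M a : ℝ, 0 < M ∧ 10 * |a| ≤ 9 * M ∧ ρ = Literature.Geometry.Lorentzian.Kerr.rPlus M a - M / 4 ∧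 (∀ x, B.radius x = Literature.Geometry.Lorentzian.Kerr.radius a x) ∧ ∀ m ≤ 10, ∀ x ∈ (B.domain : Set Literature.Geometry.Lorentzian.E4), ‖iteratedFDeriv ℝ m (fun y ↦ B.bilin y - Literature.Geometry.Lorentzian.Kerr.bilin M a y) x‖ * Literature.Geometry.Lorentzian.Kerr.radius a x ^ (m + 1) ≤ M / 10 ^ 6; let IsSc : Literature.Geometry.Lorentzian.ModelBackground → (Literature.Geometry.Lorentzian.E4 → Literature.Geometry.Lorentzian.E4) → ℝ → Prop := fun B V ρ ↦ IsSt B V ρ ∧ 0 ≤ ρ ∧ (∀ x, B.radius x = Literature.Geometry.Lorentzian.Kerr.radius 0 x) ∧ ContDiffOn ℝ ((⊤ : ℕ∞) : WithTop ℕ∞) B.bilin (B.domain : Set Literature.Geometry.Lorentzian.E4) ∧ (∀ x ∈ (B.domain : Set Literature.Geometry.Lorentzian.E4), (∀ u : Literature.Geometry.Lorentzian.E4, u ≠ 0 → u 0 = 0 → 0 < B.bilin x u u) ∧ ∀ u v w : Literature.Geometry.Lorentzian.E4, B.bilin x (Literature.Geometry.Lorentzian.E4.basisVector 0) u * (fderiv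 ℝ B.bilin x v (Literature.Geometry.Lorentzian.E4.basisVector 0) w - fderiv ℝ B.bilin x w (Literature.Geometry.Lorentzian.E4.basisVector 0) v) + B.bilin x (Literature.Geometry.Lorentzian.E4.basisVector 0) v * (fderiv ℝ B.bilin x w (Literature.Geometry.Lorentzian.E4.basisVector 0) u - fderiv ℝ B.bilin x u (Literature.Geometry.Lorentzian.E4.basisVector 0) w) + B.bilin x (Literature.Geometry.Lorentzian.E4.basisVector 0) w * (fderiv ℝ B.bilin x u (Literature.Geometry.Lorentzian.E4.basisVector 0) v - fderiv ℝ B.bilin x v (Literature.Geometry.Lorentzian.E4.basisVector 0) u) = 0) ∧ (∃ R₀ : ℝ, ∀ x ∈ (B.domain : Set Literature.Geometry.Lorentzian.E4), R₀ < B.radius x → B.bilin x (Literature.Geometry.Lorentzian.E4.basisVector 0) (Literature.Geometry.Lorentzian.E4.basisVector 0) < 0) ∧ ∃ ρH : ℝ, ρ < ρH ∧ ∀ x ∈ (B.domain : Set Literature.Geometry.Lorentzian.E4), B.radius x ≤ ρH → ∀ u : Literature.Geometry.Lorentzian.E4, B.bilin x u u ≤ 0 → B.bilin x u (V x) < 0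 → x 1 * u 1 + x 2 * u 2 + x 3 * u 3 ≤ 0; let St : Literature.Geometry.Lorentzian.InitialDataSet (𝓡 3) X → Prop := fun D ↦ ∀ 𝒟 : Literature.Geometry.Lorentzian.VacuumCauchyDevelopment D, 𝒟.IsMaximal → ∃ (O : Set 𝒟.carrier) (N : ℕ) (B : Fin N → Literature.Geometry.Lorentzian.ModelBackground) (V : Fin N → Literature.Geometry.Lorentzian.E4 → Literature.Geometry.Lorentzian.E4) (ρ : Fin N → ℝ) (motion : Fin N → Literature.Geometry.Lorentzian.lorentzGroup × Literature.Geometry.Lorentzian.E4) (d : Literature.Geometry.Lorentzian.FinalStateDecompositionOver 𝒟.toSpacetime O 2 (fun i ↦ (B i).boost (motion i).1 (motion i).2)), (∀ i, IsSt (B i) (V i) (ρ i)) ∧ O = Summit.FinalStateConjecture.exteriorOf 𝒟.toCauchyDevelopment d.charted ∧ Summit.FinalStateConjecture.RaysStayInClosure 𝒟.toCauchyDevelopment O ∧ (∃ R : Fin N → ℝ → ℝ, (∀ i, Tendsto (R i) atTop atTop ∧ ∀ τ, ρ i + 1 ≤ R i τ) ∧ (∀ i, Tendsto (fun τ ↦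 𝒟.toSpacetime.truncDeviationCk ((B i).boost (motion i).1 (motion i).2) (d.chart i) 2 (R i τ) τ) atTop (𝓝 0)) ∧ ∀ τ₁ : ℝ, d.τ₀ < τ₁ → O \ d.certifiedLate R τ₁ ⊆ 𝒟.toSpacetime.metric.causalPast 𝒟.toSpacetime.timeOrientation (d.certifiedSlab R τ₁)) ∧ (∀ i, Summit.FinalStateConjecture.IsOrthochronous (motion i).1) ∧ (∀ i (ρ' : ℝ), ∀ᶠ τ in atTop, ∀ x ∈ ((B i).boost (motion i).1 (motion i).2).truncTimeSlab ρ' τ, 𝒟.toSpacetime.timeOrientation.IsFutureDirected (mfderiv 𝓘(ℝ, Literature.Geometry.Lorentzian.E4) (𝓡 4) (d.chart i) x (((motion i).1 : Literature.Geometry.Lorentzian.E4 ≃L[ℝ] Literature.Geometry.Lorentzian.E4) (V i (Literature.Geometry.Lorentzian.poincareInv (motion i).1 (motion i).2 (x : Literature.Geometry.Lorentzian.E4)))))) ∧ ∀ᶠ τ in atTop, ∀ x ∈ (Literature.Geometry.Lorentzian.Minkowski.backgroundOn d.flatDomain).timeSlab τ, 𝒟.toSpacetime.timeOrientation.IsFutureDirected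 (mfderiv 𝓘(ℝ, Literature.Geometry.Lorentzian.E4) (𝓡 4) d.flatChart x (Literature.Geometry.Lorentzian.E4.basisVector 0)); let StS : Literature.Geometry.Lorentzian.InitialDataSet (𝓡 3) X → Prop := fun D ↦ ∀ 𝒟 : Literature.Geometry.Lorentzian.VacuumCauchyDevelopment D, 𝒟.IsMaximal → ∃ (O : Set 𝒟.carrier) (N : ℕ) (B : Fin N → Literature.Geometry.Lorentzian.ModelBackground) (V : Fin N → Literature.Geometry.Lorentzian.E4 → Literature.Geometry.Lorentzian.E4) (ρ : Fin N → ℝ) (motion : Fin N → Literature.Geometry.Lorentzian.lorentzGroup × Literature.Geometry.Lorentzian.E4) (d : Literature.Geometry.Lorentzian.FinalStateDecompositionOver 𝒟.toSpacetime O 2 (fun i ↦ (B i).boost (motion i).1 (motion i).2)), (∀ i, IsSc (B i) (V i) (ρ i)) ∧ O = Summit.FinalStateConjecture.exteriorOf 𝒟.toCauchyDevelopment d.charted ∧ Summit.FinalStateConjecture.RaysStayInClosure 𝒟.toCauchyDevelopment O ∧ (∃ R : Fin N → ℝ → ℝ, (∀ i, Tendsto (R i) atTop atTop ∧ ∀ τ,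 ρ i + 1 ≤ R i τ) ∧ (∀ i, Tendsto (fun τ ↦ 𝒟.toSpacetime.truncDeviationCk ((B i).boost (motion i).1 (motion i).2) (d.chart i) 2 (R i τ) τ) atTop (𝓝 0)) ∧ ∀ τ₁ : ℝ, d.τ₀ < τ₁ → O \ d.certifiedLate R τ₁ ⊆ 𝒟.toSpacetime.metric.causalPast 𝒟.toSpacetime.timeOrientation (d.certifiedSlab R τ₁)) ∧ (∀ i, Summit.FinalStateConjecture.IsOrthochronous (motion i).1) ∧ (∀ i (ρ' : ℝ), ∀ᶠ τ in atTop, ∀ x ∈ ((B i).boost (motion i).1 (motion i).2).truncTimeSlab ρ' τ, 𝒟.toSpacetime.timeOrientation.IsFutureDirected (mfderiv 𝓘(ℝ, Literature.Geometry.Lorentzian.E4) (𝓡 4) (d.chart i) x (((motion i).1 : Literature.Geometry.Lorentzian.E4 ≃L[ℝ] Literature.Geometry.Lorentzian.E4) (V i (Literature.Geometry.Lorentzian.poincareInv (motion i).1 (motion i).2 (x : Literature.Geometry.Lorentzian.E4)))))) ∧ ∀ᶠ τ in atTop, ∀ x ∈ (Literature.Geometry.Lorentzian.Minkowski.backgroundOn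 d.flatDomain).timeSlab τ, 𝒟.toSpacetime.timeOrientation.IsFutureDirected (mfderiv 𝓘(ℝ, Literature.Geometry.Lorentzian.E4) (𝓡 4) d.flatChart x (Literature.Geometry.Lorentzian.E4.basisVector 0)); let StN : Literature.Geometry.Lorentzian.InitialDataSet (𝓡 3) X → Prop := fun D ↦ ∀ 𝒟 : Literature.Geometry.Lorentzian.VacuumCauchyDevelopment D, 𝒟.IsMaximal → ∃ (O : Set 𝒟.carrier) (N : ℕ) (B : Fin N → Literature.Geometry.Lorentzian.ModelBackground) (V : Fin N → Literature.Geometry.Lorentzian.E4 → Literature.Geometry.Lorentzian.E4) (ρ : Fin N → ℝ) (motion : Fin N → Literature.Geometry.Lorentzian.lorentzGroup × Literature.Geometry.Lorentzian.E4) (d : Literature.Geometry.Lorentzian.FinalStateDecompositionOver 𝒟.toSpacetime O 2 (fun i ↦ (B i).boost (motion i).1 (motion i).2)), (∀ i, IsNr (B i) (V i) (ρ i)) ∧ O = Summit.FinalStateConjecture.exteriorOf 𝒟.toCauchyDevelopment d.charted ∧ Summit.FinalStateConjecture.RaysStayInClosure 𝒟.toCauchyDevelopment O ∧ (∃ R :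 Fin N → ℝ → ℝ, (∀ i, Tendsto (R i) atTop atTop ∧ ∀ τ, ρ i + 1 ≤ R i τ) ∧ (∀ i, Tendsto (fun τ ↦ 𝒟.toSpacetime.truncDeviationCk ((B i).boost (motion i).1 (motion i).2) (d.chart i) 2 (R i τ) τ) atTop (𝓝 0)) ∧ ∀ τ₁ : ℝ, d.τ₀ < τ₁ → O \ d.certifiedLate R τ₁ ⊆ 𝒟.toSpacetime.metric.causalPast 𝒟.toSpacetime.timeOrientation (d.certifiedSlab R τ₁)) ∧ (∀ i, Summit.FinalStateConjecture.IsOrthochronous (motion i).1) ∧ (∀ i (ρ' : ℝ), ∀ᶠ τ in atTop, ∀ x ∈ ((B i).boost (motion i).1 (motion i).2).truncTimeSlab ρ' τ, 𝒟.toSpacetime.timeOrientation.IsFutureDirected (mfderiv 𝓘(ℝ, Literature.Geometry.Lorentzian.E4) (𝓡 4) (d.chart i) x (((motion i).1 : Literature.Geometry.Lorentzian.E4 ≃L[ℝ] Literature.Geometry.Lorentzian.E4) (V i (Literature.Geometry.Lorentzian.poincareInv (motion i).1 (motion i).2 (x : Literature.Geometry.Lorentzian.E4)))))) ∧ ∀ᶠ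 τ in atTop, ∀ x ∈ (Literature.Geometry.Lorentzian.Minkowski.backgroundOn d.flatDomain).timeSlab τ, 𝒟.toSpacetime.timeOrientation.IsFutureDirected (mfderiv 𝓘(ℝ, Literature.Geometry.Lorentzian.E4) (𝓡 4) d.flatChart x (Literature.Geometry.Lorentzian.E4.basisVector 0)); let K : Literature.Geometry.Lorentzian.InitialDataSet (𝓡 3) X → Prop := fun D ↦ ∀ 𝒟 : Literature.Geometry.Lorentzian.VacuumCauchyDevelopment D, 𝒟.IsMaximal → ∃ (O : Set 𝒟.carrier) (d : Literature.Geometry.Lorentzian.FinalStateDecomposition 𝒟.toSpacetime O 2), (∀ i, Literature.Geometry.Lorentzian.Kerr.IsSubextremal (d.mass i) (d.spin i)) ∧ O = Summit.FinalStateConjecture.exteriorOf 𝒟.toCauchyDevelopment d.charted ∧ Summit.FinalStateConjecture.RaysStayInClosure 𝒟.toCauchyDevelopment O ∧ Summit.FinalStateConjecture.HasExhaustiveCharts d ∧ Summit.FinalStateConjecture.IsFutureOriented d; Literature.Geometry.Lorentzian.InitialDataSet.IsTameChristodoulouGeneric (Literature.Geometry.Lorentzian.admissibleVacuumData X) (fun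 D ↦ St D → ¬ StS D → ¬ StN D → K D) 1

-- parent: NonStaticNoHair · child (gen 1)
/--     item stmt-FinalStateConjecture-30059 · crux · rank 202 · open
    parent: NonStaticNoHair · by planner
    why it might fail: a tame-open set of admissible data may settle to a smooth stationary NON-axisymmetric vacuum black hole with a trapped collar: rigidity without analyticity is open away from Kerr (unique continuation across the ergoregion fails on T-trapped null geodesics)
    sources: arXiv:1501.01587, arXiv:0902.1173, arXiv:0904.0982, arXiv:gr-qc/9811021, arXiv:1205.6112, arXiv:1105.5830
[crux · NEW RESIDUAL E of S₂ · WEAKER · COUNTS (named-problem column: Hawking rigidity without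
analyticity for dynamically reached non-degenerate rotating end states + coaxial multi-horizon
equilibria) · INSIDE IonescuKlainermanNonExtension as typed · IDEA-NEEDED · PARKED · lens-3 g7
«AxisymmetricJunction» on stmt-29012, critic CLEARED 2026-08-30T07:06:59Z row 76] [crux · child E of
S₂ stmt-29012 · WEAKER · COUNTS · NEW RESIDUAL = RIGIDITY WITHOUT ANALYTICITY · IDEA-NEEDED · inside
IonescuKlainermanNonExtension as typed] NON-AXISYMMETRIC NO-HAIR: tame-Christodoulou-generically, an
admissible datum whose MGHDs settle to HORIZON-COLLAR MODELS (StH := StC IsHc: smooth stationary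
forms with Kerr–Schild-type radius, spacelike slices, uniformly stationary far end and a strictly
trapped open collar inside each hole) admitting NO axisymmetric horizon-collar presentation (¬ StA),
no smooth static one (¬ StS) and no slow-near-Kerr one (¬ StN) settles to boosted sub-extremal Kerr
exteriors (K). = S₂ relieved, BY CONSTRUCTION and ε-free, of every axisymmetric end state and of
every end state without horizon-collar normal form: what remains is «a smooth stationary vacuum
black-hole end state wi -/
@[route_item "route-FinalStateConjecture-RootDecompAxisymmetricJunction"]
def NonAxisymmetricNoHair : Prop :=
  ∀ (X : Type) [TopologicalSpace X] [ChartedSpace Literature.Geometry.Lorentzian.E3 X] [IsManifold (𝓡 3) ((⊤ : ℕ∞) : WithTop ℕ∞) X] [T2Space X] [SecondCountableTopology X] [ConnectedSpace X], let IsSt : Literature.Geometry.Lorentzian.ModelBackground → (Literature.Geometry.Lorentzian.E4 → Literature.Geometry.Lorentzian.E4) → ℝ → Prop := fun B V ρ ↦ (∀ x, B.time x = x 0) ∧ ((B.domain : Set Literature.Geometry.Lorentzian.E4) = {x | ρ < B.radius x}) ∧ (∀ (t : ℝ) (y : Literature.Geometry.Lorentzian.E3), B.radius (Literature.Geometry.Lorentzian.E4.ofTimeSpace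 t y) = B.radius (Literature.Geometry.Lorentzian.E4.ofTimeSpace 0 y)) ∧ (∀ (t : ℝ) (y : Literature.Geometry.Lorentzian.E3), B.bilin (Literature.Geometry.Lorentzian.E4.ofTimeSpace t y) = B.bilin (Literature.Geometry.Lorentzian.E4.ofTimeSpace 0 y)) ∧ (∀ (t : ℝ) (y : Literature.Geometry.Lorentzian.E3), V (Literature.Geometry.Lorentzian.E4.ofTimeSpace t y) = V (Literature.Geometry.Lorentzian.E4.ofTimeSpace 0 y)) ∧ ∀ x ∈ B.domain, B.bilin x (V x) (V x) < 0 ∧ 0 < V x 0; let IsNr : Literature.Geometry.Lorentzian.ModelBackground → (Literature.Geometry.Lorentzian.E4 → Literature.Geometry.Lorentzian.E4) → ℝ → Prop := fun B V ρ ↦ IsSt B V ρ ∧ ContDiffOn ℝ ((⊤ : ℕ∞) : WithTop ℕ∞) B.bilin (B.domain : Set Literature.Geometry.Lorentzian.E4) ∧ ∃ M a : ℝ, 0 < M ∧ 10 * |a| ≤ 9 * M ∧ ρ = Literature.Geometry.Lorentzian.Kerr.rPlus M a - M / 4 ∧ (∀ x, B.radius x = Literature.Geometry.Lorentzian.Kerr.radius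 a x) ∧ ∀ m ≤ 10, ∀ x ∈ (B.domain : Set Literature.Geometry.Lorentzian.E4), ‖iteratedFDeriv ℝ m (fun y ↦ B.bilin y - Literature.Geometry.Lorentzian.Kerr.bilin M a y) x‖ * Literature.Geometry.Lorentzian.Kerr.radius a x ^ (m + 1) ≤ M / 10 ^ 6; let IsSc : Literature.Geometry.Lorentzian.ModelBackground → (Literature.Geometry.Lorentzian.E4 → Literature.Geometry.Lorentzian.E4) → ℝ → Prop := fun B V ρ ↦ IsSt B V ρ ∧ 0 ≤ ρ ∧ (∀ x, B.radius x = Literature.Geometry.Lorentzian.Kerr.radius 0 x) ∧ ContDiffOn ℝ ((⊤ : ℕ∞) : WithTop ℕ∞) B.bilin (B.domain : Set Literature.Geometry.Lorentzian.E4) ∧ (∀ x ∈ (B.domain : Set Literature.Geometry.Lorentzian.E4), (∀ u : Literature.Geometry.Lorentzian.E4, u ≠ 0 → u 0 = 0 → 0 < B.bilin x u u) ∧ ∀ u v w : Literature.Geometry.Lorentzian.E4, B.bilin x (Literature.Geometry.Lorentzian.E4.basisVector 0) u * (fderiv ℝ B.bilin x v (Literature.Geometry.Lorentzian.E4.basisVector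 0) w - fderiv ℝ B.bilin x w (Literature.Geometry.Lorentzian.E4.basisVector 0) v) + B.bilin x (Literature.Geometry.Lorentzian.E4.basisVector 0) v * (fderiv ℝ B.bilin x w (Literature.Geometry.Lorentzian.E4.basisVector 0) u - fderiv ℝ B.bilin x u (Literature.Geometry.Lorentzian.E4.basisVector 0) w) + B.bilin x (Literature.Geometry.Lorentzian.E4.basisVector 0) w * (fderiv ℝ B.bilin x u (Literature.Geometry.Lorentzian.E4.basisVector 0) v - fderiv ℝ B.bilin x v (Literature.Geometry.Lorentzian.E4.basisVector 0) u) = 0) ∧ (∃ R₀ : ℝ, ∀ x ∈ (B.domain : Set Literature.Geometry.Lorentzian.E4), R₀ < B.radius x → B.bilin x (Literature.Geometry.Lorentzian.E4.basisVector 0) (Literature.Geometry.Lorentzian.E4.basisVector 0) < 0) ∧ ∃ ρH : ℝ, ρ < ρH ∧ ∀ x ∈ (B.domain : Set Literature.Geometry.Lorentzian.E4), B.radius x ≤ ρH → ∀ u : Literature.Geometry.Lorentzian.E4, B.bilin x u u ≤ 0 → B.bilin x u (V x) < 0 → x 1 * u 1 + x 2 * u 2 + x 3 * u 3 ≤ 0;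 let IsTb : Literature.Geometry.Lorentzian.ModelBackground → (Literature.Geometry.Lorentzian.E4 → Literature.Geometry.Lorentzian.E4) → ℝ → Prop := fun B V ρH ↦ ∀ x ∈ (B.domain : Set Literature.Geometry.Lorentzian.E4), B.radius x < ρH → ∀ u : Literature.Geometry.Lorentzian.E4, u ≠ 0 → B.bilin x u u ≤ 0 → B.bilin x u (V x) < 0 → fderiv ℝ B.radius x u < 0; let IsHc : Literature.Geometry.Lorentzian.ModelBackground → (Literature.Geometry.Lorentzian.E4 → Literature.Geometry.Lorentzian.E4) → ℝ → Prop := fun B V ρ ↦ IsSt B V ρ ∧ 0 ≤ ρ ∧ (∃ a' : ℝ, ∀ x, B.radius x = Literature.Geometry.Lorentzian.Kerr.radius a' x) ∧ ContDiffOn ℝ ((⊤ : ℕ∞) : WithTop ℕ∞) B.bilin (B.domain : Set Literature.Geometry.Lorentzian.E4) ∧ (∀ x ∈ (B.domain : Set Literature.Geometry.Lorentzian.E4), ∀ u : Literature.Geometry.Lorentzian.E4, u ≠ 0 → u 0 = 0 → 0 < B.bilin x u u) ∧ (∃ R₀ c : ℝ, 0 < c ∧ ∀ x ∈ (B.domain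 : Set Literature.Geometry.Lorentzian.E4), R₀ < B.radius x → B.bilin x (Literature.Geometry.Lorentzian.E4.basisVector 0) (Literature.Geometry.Lorentzian.E4.basisVector 0) ≤ -c ∧ ∀ u : Literature.Geometry.Lorentzian.E4, u 0 = 0 → c * ‖u‖ ^ 2 ≤ B.bilin x u u) ∧ ∃ ρH : ℝ, ρ < ρH ∧ IsTb B V ρH; let Jv : Literature.Geometry.Lorentzian.E4 → Literature.Geometry.Lorentzian.E4 := fun x ↦ x 1 • (Literature.Geometry.Lorentzian.E4.basisVector 2) - x 2 • (Literature.Geometry.Lorentzian.E4.basisVector 1); let IsAc : Literature.Geometry.Lorentzian.ModelBackground → (Literature.Geometry.Lorentzian.E4 → Literature.Geometry.Lorentzian.E4) → ℝ → Prop := fun B V ρ ↦ IsHc B V ρ ∧ (∀ x ∈ (B.domain : Set Literature.Geometry.Lorentzian.E4), ∀ v w : Literature.Geometry.Lorentzian.E4, fderiv ℝ B.bilin x (Jv x) v w + B.bilin x (Jv v) w + B.bilin x v (Jv w) = 0) ∧ ∃ ρH : ℝ, ρ < ρH ∧ IsTb B V ρH ∧ ∀ x ∈ (B.domain : Set Literature.Geometry.Lorentzian.E4),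 Jv x ≠ 0 → (ρH < B.radius x ↔ B.bilin x (Literature.Geometry.Lorentzian.E4.basisVector 0) (Literature.Geometry.Lorentzian.E4.basisVector 0) * B.bilin x (Jv x) (Jv x) - B.bilin x (Literature.Geometry.Lorentzian.E4.basisVector 0) (Jv x) ^ 2 < 0); let StC : (Literature.Geometry.Lorentzian.ModelBackground → (Literature.Geometry.Lorentzian.E4 → Literature.Geometry.Lorentzian.E4) → ℝ → Prop) → Literature.Geometry.Lorentzian.InitialDataSet (𝓡 3) X → Prop := fun C D ↦ ∀ 𝒟 : Literature.Geometry.Lorentzian.VacuumCauchyDevelopment D, 𝒟.IsMaximal → ∃ (O : Set 𝒟.carrier) (N : ℕ) (B : Fin N → Literature.Geometry.Lorentzian.ModelBackground) (V : Fin N → Literature.Geometry.Lorentzian.E4 → Literature.Geometry.Lorentzian.E4) (ρ : Fin N → ℝ) (motion : Fin N → Literature.Geometry.Lorentzian.lorentzGroup × Literature.Geometry.Lorentzian.E4) (d : Literature.Geometry.Lorentzian.FinalStateDecompositionOver 𝒟.toSpacetime O 2 (fun i ↦ (B i).boost (motion i).1 (motion i).2)), (∀ i, C (B i) (V i) (ρ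 i)) ∧ O = Summit.FinalStateConjecture.exteriorOf 𝒟.toCauchyDevelopment d.charted ∧ Summit.FinalStateConjecture.RaysStayInClosure 𝒟.toCauchyDevelopment O ∧ (∃ R : Fin N → ℝ → ℝ, (∀ i, Tendsto (R i) atTop atTop ∧ ∀ τ, ρ i + 1 ≤ R i τ) ∧ (∀ i, Tendsto (fun τ ↦ 𝒟.toSpacetime.truncDeviationCk ((B i).boost (motion i).1 (motion i).2) (d.chart i) 2 (R i τ) τ) atTop (𝓝 0)) ∧ ∀ τ₁ : ℝ, d.τ₀ < τ₁ → O \ d.certifiedLate R τ₁ ⊆ 𝒟.toSpacetime.metric.causalPast 𝒟.toSpacetime.timeOrientation (d.certifiedSlab R τ₁)) ∧ (∀ i, Summit.FinalStateConjecture.IsOrthochronous (motion i).1) ∧ (∀ i (ρ' : ℝ), ∀ᶠ τ in atTop, ∀ x ∈ ((B i).boost (motion i).1 (motion i).2).truncTimeSlab ρ' τ, 𝒟.toSpacetime.timeOrientation.IsFutureDirected (mfderiv 𝓘(ℝ, Literature.Geometry.Lorentzian.E4) (𝓡 4) (d.chart i) x (((motion i).1 : Literature.Geometry.Lorentzian.E4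 ≃L[ℝ] Literature.Geometry.Lorentzian.E4) (V i (Literature.Geometry.Lorentzian.poincareInv (motion i).1 (motion i).2 (x : Literature.Geometry.Lorentzian.E4)))))) ∧ ∀ᶠ τ in atTop, ∀ x ∈ (Literature.Geometry.Lorentzian.Minkowski.backgroundOn d.flatDomain).timeSlab τ, 𝒟.toSpacetime.timeOrientation.IsFutureDirected (mfderiv 𝓘(ℝ, Literature.Geometry.Lorentzian.E4) (𝓡 4) d.flatChart x (Literature.Geometry.Lorentzian.E4.basisVector 0)); let StH := StC IsHc; let StA := StC IsAc; let StS := StC IsSc; let StN := StC IsNr; let K : Literature.Geometry.Lorentzian.InitialDataSet (𝓡 3) X → Prop := fun D ↦ ∀ 𝒟 : Literature.Geometry.Lorentzian.VacuumCauchyDevelopment D, 𝒟.IsMaximal → ∃ (O : Set 𝒟.carrier) (d : Literature.Geometry.Lorentzian.FinalStateDecomposition 𝒟.toSpacetime O 2), (∀ i, Literature.Geometry.Lorentzian.Kerr.IsSubextremal (d.mass i) (d.spin i)) ∧ O = Summit.FinalStateConjecture.exteriorOf 𝒟.toCauchyDevelopment d.charted ∧ Summit.FinalStateConjecture.RaysStayInClosure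 𝒟.toCauchyDevelopment O ∧ Summit.FinalStateConjecture.HasExhaustiveCharts d ∧ Summit.FinalStateConjecture.IsFutureOriented d; Literature.Geometry.Lorentzian.InitialDataSet.IsTameChristodoulouGeneric (Literature.Geometry.Lorentzian.admissibleVacuumData X) (fun D ↦ StH D → ¬ StA D → ¬ StS D → ¬ StN D → K D) 1

-- parent: NonStaticNoHair · child (gen 1)
/--     item stmt-FinalStateConjecture-30060 · crux · rank 203 · open
    parent: NonStaticNoHair · by planner
    why it might fail: the third law may fail openly: a tame-open set of admissible data could settle to extremal Kerr (no trapped collar), or to stationary ends whose C²-limit admits no smooth horizon-penetrating Kerr–Schild-radius normal form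
    sources: arXiv:2211.15742, arXiv:2402.10190, arXiv:1206.6598, doi:10.1103/PhysRevD.77.084005, arXiv:1510.01759, arXiv:1310.0339
[crux · cell F · WEAKER · COUNTS-small (generic third law / extremal stratum inside the Aretakis
class; sub-truncation horizons; non-uniform far ends) · INSTRUMENTABLE (near-extremal settling tails
→ census) · PARKED · lens-3 g7 «AxisymmetricJunction» on stmt-29012, critic CLEARED
2026-08-30T07:06:59Z row 76] [crux · child F of S₂ stmt-29012 · WEAKER · COUNTS-small ·
INSTRUMENTABLE · third-law / normal-form residual] COLLARLESS NO-HAIR: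
tame-Christodoulou-generically, an admissible datum whose MGHDs settle to boosted stationary models
(St, born) admitting NO horizon-collar presentation at all (¬ StH: in every admissible presentation
some hole's limit form is only C²-rough, or has no Kerr–Schild-type radius with spacelike slices, or
no uniformly stationary far end, or NO STRICTLY TRAPPED OPEN COLLAR above the truncation radius —
the signature of a DEGENERATE/EXTREMAL horizon (extremal Kerr–Newman-type horizons have no trapped
surfaces just inside: Booth–Fairhurst 2008; Booth 2016 §2) or of a horizon hidden below every
admissible truncation), and no static / slow-near-Kerr one, settles to boosted sub-extremal Kerr
exteriors (K). Content = the GENERIC THIRD LAW for end states (extrema -/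
@[route_item "route-FinalStateConjecture-RootDecompAxisymmetricJunction"]
def CollarlessNoHair : Prop :=
  ∀ (X : Type) [TopologicalSpace X] [ChartedSpace Literature.Geometry.Lorentzian.E3 X] [IsManifold (𝓡 3) ((⊤ : ℕ∞) : WithTop ℕ∞) X] [T2Space X] [SecondCountableTopology X] [ConnectedSpace X], let IsSt : Literature.Geometry.Lorentzian.ModelBackground → (Literature.Geometry.Lorentzian.E4 → Literature.Geometry.Lorentzian.E4) → ℝ → Prop := fun B V ρ ↦ (∀ x, B.time x = x 0) ∧ ((B.domain : Set Literature.Geometry.Lorentzian.E4) = {x | ρ < B.radius x}) ∧ (∀ (t : ℝ) (y : Literature.Geometry.Lorentzian.E3), B.radius (Literature.Geometry.Lorentzian.E4.ofTimeSpace t y) = B.radius (Literature.Geometry.Lorentzian.E4.ofTimeSpace 0 y)) ∧ (∀ (t : ℝ) (y : Literature.Geometry.Lorentzian.E3), B.bilin (Literature.Geometry.Lorentzian.E4.ofTimeSpace t y) = B.bilin (Literature.Geometry.Lorentzian.E4.ofTimeSpace 0 y)) ∧ (∀ (t : ℝ) (y : Literature.Geometry.Lorentzian.E3), V (Literature.Geometry.Lorentzian.E4.ofTimeSpace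 t y) = V (Literature.Geometry.Lorentzian.E4.ofTimeSpace 0 y)) ∧ ∀ x ∈ B.domain, B.bilin x (V x) (V x) < 0 ∧ 0 < V x 0; let IsNr : Literature.Geometry.Lorentzian.ModelBackground → (Literature.Geometry.Lorentzian.E4 → Literature.Geometry.Lorentzian.E4) → ℝ → Prop := fun B V ρ ↦ IsSt B V ρ ∧ ContDiffOn ℝ ((⊤ : ℕ∞) : WithTop ℕ∞) B.bilin (B.domain : Set Literature.Geometry.Lorentzian.E4) ∧ ∃ M a : ℝ, 0 < M ∧ 10 * |a| ≤ 9 * M ∧ ρ = Literature.Geometry.Lorentzian.Kerr.rPlus M a - M / 4 ∧ (∀ x, B.radius x = Literature.Geometry.Lorentzian.Kerr.radius a x) ∧ ∀ m ≤ 10, ∀ x ∈ (B.domain : Set Literature.Geometry.Lorentzian.E4), ‖iteratedFDeriv ℝ m (fun y ↦ B.bilin y - Literature.Geometry.Lorentzian.Kerr.bilin M a y) x‖ * Literature.Geometry.Lorentzian.Kerr.radius a x ^ (m + 1) ≤ M / 10 ^ 6; let IsSc : Literature.Geometry.Lorentzian.ModelBackground → (Literature.Geometry.Lorentzian.E4 →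 Literature.Geometry.Lorentzian.E4) → ℝ → Prop := fun B V ρ ↦ IsSt B V ρ ∧ 0 ≤ ρ ∧ (∀ x, B.radius x = Literature.Geometry.Lorentzian.Kerr.radius 0 x) ∧ ContDiffOn ℝ ((⊤ : ℕ∞) : WithTop ℕ∞) B.bilin (B.domain : Set Literature.Geometry.Lorentzian.E4) ∧ (∀ x ∈ (B.domain : Set Literature.Geometry.Lorentzian.E4), (∀ u : Literature.Geometry.Lorentzian.E4, u ≠ 0 → u 0 = 0 → 0 < B.bilin x u u) ∧ ∀ u v w : Literature.Geometry.Lorentzian.E4, B.bilin x (Literature.Geometry.Lorentzian.E4.basisVector 0) u * (fderiv ℝ B.bilin x v (Literature.Geometry.Lorentzian.E4.basisVector 0) w - fderiv ℝ B.bilin x w (Literature.Geometry.Lorentzian.E4.basisVector 0) v) + B.bilin x (Literature.Geometry.Lorentzian.E4.basisVector 0) v * (fderiv ℝ B.bilin x w (Literature.Geometry.Lorentzian.E4.basisVector 0) u - fderiv ℝ B.bilin x u (Literature.Geometry.Lorentzian.E4.basisVector 0) w) + B.bilin x (Literature.Geometry.Lorentzian.E4.basisVector 0) w * (fderiv ℝ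 B.bilin x u (Literature.Geometry.Lorentzian.E4.basisVector 0) v - fderiv ℝ B.bilin x v (Literature.Geometry.Lorentzian.E4.basisVector 0) u) = 0) ∧ (∃ R₀ : ℝ, ∀ x ∈ (B.domain : Set Literature.Geometry.Lorentzian.E4), R₀ < B.radius x → B.bilin x (Literature.Geometry.Lorentzian.E4.basisVector 0) (Literature.Geometry.Lorentzian.E4.basisVector 0) < 0) ∧ ∃ ρH : ℝ, ρ < ρH ∧ ∀ x ∈ (B.domain : Set Literature.Geometry.Lorentzian.E4), B.radius x ≤ ρH → ∀ u : Literature.Geometry.Lorentzian.E4, B.bilin x u u ≤ 0 → B.bilin x u (V x) < 0 → x 1 * u 1 + x 2 * u 2 + x 3 * u 3 ≤ 0; let IsTb : Literature.Geometry.Lorentzian.ModelBackground → (Literature.Geometry.Lorentzian.E4 → Literature.Geometry.Lorentzian.E4) → ℝ → Prop := fun B V ρH ↦ ∀ x ∈ (B.domain : Set Literature.Geometry.Lorentzian.E4), B.radius x < ρH → ∀ u : Literature.Geometry.Lorentzian.E4, u ≠ 0 → B.bilin x u u ≤ 0 → B.bilin x u (V x) < 0 → fderiv ℝ B.radius x u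 < 0; let IsHc : Literature.Geometry.Lorentzian.ModelBackground → (Literature.Geometry.Lorentzian.E4 → Literature.Geometry.Lorentzian.E4) → ℝ → Prop := fun B V ρ ↦ IsSt B V ρ ∧ 0 ≤ ρ ∧ (∃ a' : ℝ, ∀ x, B.radius x = Literature.Geometry.Lorentzian.Kerr.radius a' x) ∧ ContDiffOn ℝ ((⊤ : ℕ∞) : WithTop ℕ∞) B.bilin (B.domain : Set Literature.Geometry.Lorentzian.E4) ∧ (∀ x ∈ (B.domain : Set Literature.Geometry.Lorentzian.E4), ∀ u : Literature.Geometry.Lorentzian.E4, u ≠ 0 → u 0 = 0 → 0 < B.bilin x u u) ∧ (∃ R₀ c : ℝ, 0 < c ∧ ∀ x ∈ (B.domain : Set Literature.Geometry.Lorentzian.E4), R₀ < B.radius x → B.bilin x (Literature.Geometry.Lorentzian.E4.basisVector 0) (Literature.Geometry.Lorentzian.E4.basisVector 0) ≤ -c ∧ ∀ u : Literature.Geometry.Lorentzian.E4, u 0 = 0 → c * ‖u‖ ^ 2 ≤ B.bilin x u u) ∧ ∃ ρH : ℝ, ρ < ρH ∧ IsTb B V ρH; let StC : (Literature.Geometry.Lorentzian.ModelBackground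 → (Literature.Geometry.Lorentzian.E4 → Literature.Geometry.Lorentzian.E4) → ℝ → Prop) → Literature.Geometry.Lorentzian.InitialDataSet (𝓡 3) X → Prop := fun C D ↦ ∀ 𝒟 : Literature.Geometry.Lorentzian.VacuumCauchyDevelopment D, 𝒟.IsMaximal → ∃ (O : Set 𝒟.carrier) (N : ℕ) (B : Fin N → Literature.Geometry.Lorentzian.ModelBackground) (V : Fin N → Literature.Geometry.Lorentzian.E4 → Literature.Geometry.Lorentzian.E4) (ρ : Fin N → ℝ) (motion : Fin N → Literature.Geometry.Lorentzian.lorentzGroup × Literature.Geometry.Lorentzian.E4) (d : Literature.Geometry.Lorentzian.FinalStateDecompositionOver 𝒟.toSpacetime O 2 (fun i ↦ (B i).boost (motion i).1 (motion i).2)), (∀ i, C (B i) (V i) (ρ i)) ∧ O = Summit.FinalStateConjecture.exteriorOf 𝒟.toCauchyDevelopment d.charted ∧ Summit.FinalStateConjecture.RaysStayInClosure 𝒟.toCauchyDevelopment O ∧ (∃ R : Fin N → ℝ → ℝ, (∀ i, Tendsto (R i) atTop atTop ∧ ∀ τ, ρ i + 1 ≤ R i τ) ∧ (∀ i, Tendsto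 (fun τ ↦ 𝒟.toSpacetime.truncDeviationCk ((B i).boost (motion i).1 (motion i).2) (d.chart i) 2 (R i τ) τ) atTop (𝓝 0)) ∧ ∀ τ₁ : ℝ, d.τ₀ < τ₁ → O \ d.certifiedLate R τ₁ ⊆ 𝒟.toSpacetime.metric.causalPast 𝒟.toSpacetime.timeOrientation (d.certifiedSlab R τ₁)) ∧ (∀ i, Summit.FinalStateConjecture.IsOrthochronous (motion i).1) ∧ (∀ i (ρ' : ℝ), ∀ᶠ τ in atTop, ∀ x ∈ ((B i).boost (motion i).1 (motion i).2).truncTimeSlab ρ' τ, 𝒟.toSpacetime.timeOrientation.IsFutureDirected (mfderiv 𝓘(ℝ, Literature.Geometry.Lorentzian.E4) (𝓡 4) (d.chart i) x (((motion i).1 : Literature.Geometry.Lorentzian.E4 ≃L[ℝ] Literature.Geometry.Lorentzian.E4) (V i (Literature.Geometry.Lorentzian.poincareInv (motion i).1 (motion i).2 (x : Literature.Geometry.Lorentzian.E4)))))) ∧ ∀ᶠ τ in atTop, ∀ x ∈ (Literature.Geometry.Lorentzian.Minkowski.backgroundOn d.flatDomain).timeSlab τ, 𝒟.toSpacetime.timeOrientation.IsFutureDirected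 (mfderiv 𝓘(ℝ, Literature.Geometry.Lorentzian.E4) (𝓡 4) d.flatChart x (Literature.Geometry.Lorentzian.E4.basisVector 0)); let St := StC IsSt; let StH := StC IsHc; let StS := StC IsSc; let StN := StC IsNr; let K : Literature.Geometry.Lorentzian.InitialDataSet (𝓡 3) X → Prop := fun D ↦ ∀ 𝒟 : Literature.Geometry.Lorentzian.VacuumCauchyDevelopment D, 𝒟.IsMaximal → ∃ (O : Set 𝒟.carrier) (d : Literature.Geometry.Lorentzian.FinalStateDecomposition 𝒟.toSpacetime O 2), (∀ i, Literature.Geometry.Lorentzian.Kerr.IsSubextremal (d.mass i) (d.spin i)) ∧ O = Summit.FinalStateConjecture.exteriorOf 𝒟.toCauchyDevelopment d.charted ∧ Summit.FinalStateConjecture.RaysStayInClosure 𝒟.toCauchyDevelopment O ∧ Summit.FinalStateConjecture.HasExhaustiveCharts d ∧ Summit.FinalStateConjecture.IsFutureOriented d; Literature.Geometry.Lorentzian.InitialDataSet.IsTameChristodoulouGeneric (Literature.Geometry.Lorentzian.admissibleVacuumData X) (fun D ↦ St D → ¬ StH D → ¬ StS D → ¬ StN D → K D) 1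

-- parent: NonStaticNoHair · child (gen 1)
/--     item stmt-FinalStateConjecture-30061 · crux · rank 204 · open
    parent: NonStaticNoHair · by planner
    why it might fail: at a datum where St → ¬StS → ¬StN → K fails with an axisymmetric collar limit, only A's exit is handed over and its curve may re-enter non-axisymmetric or collarless limits off 0 where nothing typed forces K; joining needs door D_A or corner general position
    sources: arXiv:1205.6112, arXiv:2104.11857, Christodoulou2008BlackHoles
[crux · thin junction J · ∧/→-tax · UNDECIDED (the ∀-data door PointwiseAxisymmetricNoHair ⟹ A is
not S-implied ⇒ never an item, β-rule) · does NOT count · lens-3 g7 «AxisymmetricJunction» on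
stmt-29012, critic CLEARED 2026-08-30T07:06:59Z row 76] [crux · child J of S₂ stmt-29012 · WEAKER ·
thin · ∧/→-tax · UNDECIDED[door D_A]] COLLAR JOINT EXIT (the junction tax of A ∧ E ∧ F and nothing
more): at every admissible datum D where the non-static implication St D → ¬StS D → ¬StN D → K D
fails, a tame exit for the axisymmetric implication StA → ¬StS → ¬StN → K (handed over if it fails
at D), one for the non-axisymmetric implication StH → ¬StA → ¬StS → ¬StN → K (handed over if it
fails at D) and one for the collarless implication St → ¬StH → ¬StS → ¬StN → K (handed over if it
fails at D) yield ONE tame exit (one end, tame order-1 immersed injective admissible curve through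
D) along which St → ¬StS → ¬StN → K holds off 0. Exactly one of the three hand-overs is live at each
such D (em on StA, StH; StA ⟹ StH ⟹ St, kernel pointwise_iff). Vanishes cell-wise under the ∀-data
door PointwiseAxisymmetricNoHair (then E's or F's exit already serves); necessity S₂ ⟹ J (S₂'s own
exit, kernel collarJo -/
@[route_item "route-FinalStateConjecture-RootDecompAxisymmetricJunction"]
def CollarJointExit : Prop :=
  ∀ (X : Type) [TopologicalSpace X] [ChartedSpace Literature.Geometry.Lorentzian.E3 X] [IsManifold (𝓡 3) ((⊤ : ℕ∞) : WithTop ℕ∞) X] [T2Space X] [SecondCountableTopology X] [ConnectedSpace X], let IsSt : Literature.Geometry.Lorentzian.ModelBackground → (Literature.Geometry.Lorentzian.E4 → Literature.Geometry.Lorentzian.E4) → ℝ → Prop := fun B V ρ ↦ (∀ x, B.time x = x 0) ∧ ((B.domain : Set Literature.Geometry.Lorentzian.E4) = {x | ρ < B.radius x}) ∧ (∀ (t : ℝ) (y : Literature.Geometry.Lorentzian.E3), B.radius (Literature.Geometry.Lorentzian.E4.ofTimeSpace t y) = B.radius (Literature.Geometry.Lorentzian.E4.ofTimeSpace 0 y))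 ∧ (∀ (t : ℝ) (y : Literature.Geometry.Lorentzian.E3), B.bilin (Literature.Geometry.Lorentzian.E4.ofTimeSpace t y) = B.bilin (Literature.Geometry.Lorentzian.E4.ofTimeSpace 0 y)) ∧ (∀ (t : ℝ) (y : Literature.Geometry.Lorentzian.E3), V (Literature.Geometry.Lorentzian.E4.ofTimeSpace t y) = V (Literature.Geometry.Lorentzian.E4.ofTimeSpace 0 y)) ∧ ∀ x ∈ B.domain, B.bilin x (V x) (V x) < 0 ∧ 0 < V x 0; let IsNr : Literature.Geometry.Lorentzian.ModelBackground → (Literature.Geometry.Lorentzian.E4 → Literature.Geometry.Lorentzian.E4) → ℝ → Prop := fun B V ρ ↦ IsSt B V ρ ∧ ContDiffOn ℝ ((⊤ : ℕ∞) : WithTop ℕ∞) B.bilin (B.domain : Set Literature.Geometry.Lorentzian.E4) ∧ ∃ M a : ℝ, 0 < M ∧ 10 * |a| ≤ 9 * M ∧ ρ = Literature.Geometry.Lorentzian.Kerr.rPlus M a - M / 4 ∧ (∀ x, B.radius x = Literature.Geometry.Lorentzian.Kerr.radius a x) ∧ ∀ m ≤ 10, ∀ x ∈ (B.domain : Set Literature.Geometry.Lorentzian.E4),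 ‖iteratedFDeriv ℝ m (fun y ↦ B.bilin y - Literature.Geometry.Lorentzian.Kerr.bilin M a y) x‖ * Literature.Geometry.Lorentzian.Kerr.radius a x ^ (m + 1) ≤ M / 10 ^ 6; let IsSc : Literature.Geometry.Lorentzian.ModelBackground → (Literature.Geometry.Lorentzian.E4 → Literature.Geometry.Lorentzian.E4) → ℝ → Prop := fun B V ρ ↦ IsSt B V ρ ∧ 0 ≤ ρ ∧ (∀ x, B.radius x = Literature.Geometry.Lorentzian.Kerr.radius 0 x) ∧ ContDiffOn ℝ ((⊤ : ℕ∞) : WithTop ℕ∞) B.bilin (B.domain : Set Literature.Geometry.Lorentzian.E4) ∧ (∀ x ∈ (B.domain : Set Literature.Geometry.Lorentzian.E4), (∀ u : Literature.Geometry.Lorentzian.E4, u ≠ 0 → u 0 = 0 → 0 < B.bilin x u u) ∧ ∀ u v w : Literature.Geometry.Lorentzian.E4, B.bilin x (Literature.Geometry.Lorentzian.E4.basisVector 0) u * (fderiv ℝ B.bilin x v (Literature.Geometry.Lorentzian.E4.basisVector 0) w - fderiv ℝ B.bilin x w (Literature.Geometry.Lorentzian.E4.basisVector 0) v) + B.bilin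 x (Literature.Geometry.Lorentzian.E4.basisVector 0) v * (fderiv ℝ B.bilin x w (Literature.Geometry.Lorentzian.E4.basisVector 0) u - fderiv ℝ B.bilin x u (Literature.Geometry.Lorentzian.E4.basisVector 0) w) + B.bilin x (Literature.Geometry.Lorentzian.E4.basisVector 0) w * (fderiv ℝ B.bilin x u (Literature.Geometry.Lorentzian.E4.basisVector 0) v - fderiv ℝ B.bilin x v (Literature.Geometry.Lorentzian.E4.basisVector 0) u) = 0) ∧ (∃ R₀ : ℝ, ∀ x ∈ (B.domain : Set Literature.Geometry.Lorentzian.E4), R₀ < B.radius x → B.bilin x (Literature.Geometry.Lorentzian.E4.basisVector 0) (Literature.Geometry.Lorentzian.E4.basisVector 0) < 0) ∧ ∃ ρH : ℝ, ρ < ρH ∧ ∀ x ∈ (B.domain : Set Literature.Geometry.Lorentzian.E4), B.radius x ≤ ρH → ∀ u : Literature.Geometry.Lorentzian.E4, B.bilin x u u ≤ 0 → B.bilin x u (V x) < 0 → x 1 * u 1 + x 2 * u 2 + x 3 * u 3 ≤ 0; let IsTb : Literature.Geometry.Lorentzian.ModelBackground → (Literature.Geometry.Lorentzian.E4 → Literature.Geometry.Lorentzian.E4)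 → ℝ → Prop := fun B V ρH ↦ ∀ x ∈ (B.domain : Set Literature.Geometry.Lorentzian.E4), B.radius x < ρH → ∀ u : Literature.Geometry.Lorentzian.E4, u ≠ 0 → B.bilin x u u ≤ 0 → B.bilin x u (V x) < 0 → fderiv ℝ B.radius x u < 0; let IsHc : Literature.Geometry.Lorentzian.ModelBackground → (Literature.Geometry.Lorentzian.E4 → Literature.Geometry.Lorentzian.E4) → ℝ → Prop := fun B V ρ ↦ IsSt B V ρ ∧ 0 ≤ ρ ∧ (∃ a' : ℝ, ∀ x, B.radius x = Literature.Geometry.Lorentzian.Kerr.radius a' x) ∧ ContDiffOn ℝ ((⊤ : ℕ∞) : WithTop ℕ∞) B.bilin (B.domain : Set Literature.Geometry.Lorentzian.E4) ∧ (∀ x ∈ (B.domain : Set Literature.Geometry.Lorentzian.E4), ∀ u : Literature.Geometry.Lorentzian.E4, u ≠ 0 → u 0 = 0 → 0 < B.bilin x u u) ∧ (∃ R₀ c : ℝ, 0 < c ∧ ∀ x ∈ (B.domain : Set Literature.Geometry.Lorentzian.E4), R₀ < B.radius x → B.bilin x (Literature.Geometry.Lorentzian.E4.basisVector 0) (Literature.Geometry.Lorentzian.E4.basisVector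 0) ≤ -c ∧ ∀ u : Literature.Geometry.Lorentzian.E4, u 0 = 0 → c * ‖u‖ ^ 2 ≤ B.bilin x u u) ∧ ∃ ρH : ℝ, ρ < ρH ∧ IsTb B V ρH; let Jv : Literature.Geometry.Lorentzian.E4 → Literature.Geometry.Lorentzian.E4 := fun x ↦ x 1 • (Literature.Geometry.Lorentzian.E4.basisVector 2) - x 2 • (Literature.Geometry.Lorentzian.E4.basisVector 1); let IsAc : Literature.Geometry.Lorentzian.ModelBackground → (Literature.Geometry.Lorentzian.E4 → Literature.Geometry.Lorentzian.E4) → ℝ → Prop := fun B V ρ ↦ IsHc B V ρ ∧ (∀ x ∈ (B.domain : Set Literature.Geometry.Lorentzian.E4), ∀ v w : Literature.Geometry.Lorentzian.E4, fderiv ℝ B.bilin x (Jv x) v w + B.bilin x (Jv v) w + B.bilin x v (Jv w) = 0) ∧ ∃ ρH : ℝ, ρ < ρH ∧ IsTb B V ρH ∧ ∀ x ∈ (B.domain : Set Literature.Geometry.Lorentzian.E4), Jv x ≠ 0 → (ρH < B.radius x ↔ B.bilin x (Literature.Geometry.Lorentzian.E4.basisVector 0) (Literature.Geometry.Lorentzian.E4.basisVector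 0) * B.bilin x (Jv x) (Jv x) - B.bilin x (Literature.Geometry.Lorentzian.E4.basisVector 0) (Jv x) ^ 2 < 0); let StC : (Literature.Geometry.Lorentzian.ModelBackground → (Literature.Geometry.Lorentzian.E4 → Literature.Geometry.Lorentzian.E4) → ℝ → Prop) → Literature.Geometry.Lorentzian.InitialDataSet (𝓡 3) X → Prop := fun C D ↦ ∀ 𝒟 : Literature.Geometry.Lorentzian.VacuumCauchyDevelopment D, 𝒟.IsMaximal → ∃ (O : Set 𝒟.carrier) (N : ℕ) (B : Fin N → Literature.Geometry.Lorentzian.ModelBackground) (V : Fin N → Literature.Geometry.Lorentzian.E4 → Literature.Geometry.Lorentzian.E4) (ρ : Fin N → ℝ) (motion : Fin N → Literature.Geometry.Lorentzian.lorentzGroup × Literature.Geometry.Lorentzian.E4) (d : Literature.Geometry.Lorentzian.FinalStateDecompositionOver 𝒟.toSpacetime O 2 (fun i ↦ (B i).boost (motion i).1 (motion i).2)), (∀ i, C (B i) (V i) (ρ i)) ∧ O = Summit.FinalStateConjecture.exteriorOf 𝒟.toCauchyDevelopment d.charted ∧ Summit.FinalStateConjecture.RaysStayInClosure 𝒟.toCauchyDevelopment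 O ∧ (∃ R : Fin N → ℝ → ℝ, (∀ i, Tendsto (R i) atTop atTop ∧ ∀ τ, ρ i + 1 ≤ R i τ) ∧ (∀ i, Tendsto (fun τ ↦ 𝒟.toSpacetime.truncDeviationCk ((B i).boost (motion i).1 (motion i).2) (d.chart i) 2 (R i τ) τ) atTop (𝓝 0)) ∧ ∀ τ₁ : ℝ, d.τ₀ < τ₁ → O \ d.certifiedLate R τ₁ ⊆ 𝒟.toSpacetime.metric.causalPast 𝒟.toSpacetime.timeOrientation (d.certifiedSlab R τ₁)) ∧ (∀ i, Summit.FinalStateConjecture.IsOrthochronous (motion i).1) ∧ (∀ i (ρ' : ℝ), ∀ᶠ τ in atTop, ∀ x ∈ ((B i).boost (motion i).1 (motion i).2).truncTimeSlab ρ' τ, 𝒟.toSpacetime.timeOrientation.IsFutureDirected (mfderiv 𝓘(ℝ, Literature.Geometry.Lorentzian.E4) (𝓡 4) (d.chart i) x (((motion i).1 : Literature.Geometry.Lorentzian.E4 ≃L[ℝ] Literature.Geometry.Lorentzian.E4) (V i (Literature.Geometry.Lorentzian.poincareInv (motion i).1 (motion i).2 (x : Literature.Geometry.Lorentzian.E4))))))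 ∧ ∀ᶠ τ in atTop, ∀ x ∈ (Literature.Geometry.Lorentzian.Minkowski.backgroundOn d.flatDomain).timeSlab τ, 𝒟.toSpacetime.timeOrientation.IsFutureDirected (mfderiv 𝓘(ℝ, Literature.Geometry.Lorentzian.E4) (𝓡 4) d.flatChart x (Literature.Geometry.Lorentzian.E4.basisVector 0)); let St := StC IsSt; let StS := StC IsSc; let StN := StC IsNr; let StH := StC IsHc; let StA := StC IsAc; let K : Literature.Geometry.Lorentzian.InitialDataSet (𝓡 3) X → Prop := fun D ↦ ∀ 𝒟 : Literature.Geometry.Lorentzian.VacuumCauchyDevelopment D, 𝒟.IsMaximal → ∃ (O : Set 𝒟.carrier) (d : Literature.Geometry.Lorentzian.FinalStateDecomposition 𝒟.toSpacetime O 2), (∀ i, Literature.Geometry.Lorentzian.Kerr.IsSubextremal (d.mass i) (d.spin i)) ∧ O = Summit.FinalStateConjecture.exteriorOf 𝒟.toCauchyDevelopment d.charted ∧ Summit.FinalStateConjecture.RaysStayInClosure 𝒟.toCauchyDevelopment O ∧ Summit.FinalStateConjecture.HasExhaustiveCharts d ∧ Summit.FinalStateConjecture.IsFutureOriented d; let Exit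 : (Literature.Geometry.Lorentzian.InitialDataSet (𝓡 3) X → Prop) → Literature.Geometry.Lorentzian.InitialDataSet (𝓡 3) X → Prop := fun Q d ↦ ∃ (e : Literature.Geometry.Lorentzian.AFEnd X) (F : EuclideanSpace ℝ (Fin 1) → Literature.Geometry.Lorentzian.InitialDataSet (𝓡 3) X), Literature.Geometry.Lorentzian.InitialDataSet.IsTameDataFamily e 1 F ∧ Literature.Geometry.Lorentzian.InitialDataSet.IsImmersedAtZero 1 F ∧ F 0 = d ∧ Function.Injective F ∧ (∀ c, F c ∈ Literature.Geometry.Lorentzian.admissibleVacuumData X) ∧ ∀ c ≠ 0, Q (F c); ∀ D ∈ Literature.Geometry.Lorentzian.admissibleVacuumData X, ¬ (St D → ¬ StS D → ¬ StN D → K D) → (¬ (StA D → ¬ StS D → ¬ StN D → K D) → Exit (fun D ↦ StA D → ¬ StS D → ¬ StN D → K D) D) → (¬ (StH D → ¬ StA D → ¬ StS D → ¬ StN D → K D) → Exit (fun D ↦ StH D → ¬ StA D → ¬ StS D → ¬ StN D → K D) D) → (¬ (St D → ¬ StH D → ¬ StS D → ¬ StN D → K D) → Exit (fun D ↦ St D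 → ¬ StH D → ¬ StS D → ¬ StN D → K D) D) → Exit (fun D ↦ St D → ¬ StS D → ¬ StN D → K D) D

-- parent: NonStaticNoHair · child (gen 1)
/--     item stmt-FinalStateConjecture-30058 · support · rank 201 · open
    parent: NonStaticNoHair · by planner
    why it might fail: porting: D9 may fail — I⁺-regularity needs {r > ρ_H} globally hyperbolic and the C²-limit vacuum/AF (D7′); an axisymmetric collar limit violating them escapes CCH12 and A then carries genuine content; EH-normalised re-charting (P6) is unported
    sources: arXiv:1205.6112, arXiv:0806.0016, arXiv:1004.0513, arXiv:1310.0339, arXiv:gr-qc/0001018, arXiv:gr-qc/9311012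
[support · DOOR A · WEAKER · PROVISIONAL-EMPTY BY TREE FACT
ChruscielCostaHeusler2012_axisymmetricUniqueness BY NAME modulo ports D17 AxiCollarIPlusRegular
(flagged sub-lemma: global hyperbolicity of {r > ρ_H}) + D18 TrappedCollarNonDegenerate + D7′
StationaryLimitEndAF (wi-97106 widened) + kernel lemmas L_Y / P1a / P6 · ATTACKABLE(porting) · does
NOT count · c11 PASSED WITH FLAG · c6 anti-vacuity: rotating Kerr collar 0 < |a| < M is IsAc (kernel
isAxiCollarModel_kerrCollar) · lens-3 g7 «AxisymmetricJunction» on stmt-29012, critic CLEARED + FORM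
RULING R3 (α) 2026-08-30T07:06:59Z, CRITIC-LEDGER row 76] [crux · child A of S₂ stmt-29012 · WEAKER
· ATTACKABLE(porting) · EMPTY-BY-TREE-FACT modulo porting D7′/D9/L_nd/L_Y/P1a/P6 · ε-FREE · does NOT
count (PROVISIONAL on D9)] AXISYMMETRIC NO-HAIR: tame-Christodoulou-generically (codim ≥ 1 in
admissibleVacuumData X), an admissible datum whose MGHDs settle — in the born C² chart currency of
St VERBATIM (StA := StC IsAc, StC = the born St body abstracted over the model class) — to
AXISYMMETRIC HORIZON-COLLAR MODELS (IsAc = IsSt ∧ 0 ≤ ρ ∧ truncation radius = a Kerr–Schild radius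
r_{a′} for SOME a′ ∧ C^∞ form g₀ ∧ x⁰-slices spacelike ∧ UNIFORM -/
@[route_item "route-FinalStateConjecture-RootDecompAxisymmetricJunction"]
def AxisymmetricNoHair : Prop :=
  ∀ (X : Type) [TopologicalSpace X] [ChartedSpace Literature.Geometry.Lorentzian.E3 X] [IsManifold (𝓡 3) ((⊤ : ℕ∞) : WithTop ℕ∞) X] [T2Space X] [SecondCountableTopology X] [ConnectedSpace X], let IsSt : Literature.Geometry.Lorentzian.ModelBackground → (Literature.Geometry.Lorentzian.E4 → Literature.Geometry.Lorentzian.E4) → ℝ → Prop := fun B V ρ ↦ (∀ x, B.time x = x 0) ∧ ((B.domain : Set Literature.Geometry.Lorentzian.E4) = {x | ρ < B.radius x}) ∧ (∀ (t : ℝ) (y : Literature.Geometry.Lorentzian.E3), B.radius (Literature.Geometry.Lorentzian.E4.ofTimeSpace t y) = B.radius (Literature.Geometry.Lorentzian.E4.ofTimeSpace 0 y)) ∧ (∀ (t : ℝ) (y : Literature.Geometry.Lorentzian.E3), B.bilin (Literature.Geometry.Lorentzian.E4.ofTimeSpace t y) = B.bilin (Literature.Geometry.Lorentzian.E4.ofTimeSpace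 0 y)) ∧ (∀ (t : ℝ) (y : Literature.Geometry.Lorentzian.E3), V (Literature.Geometry.Lorentzian.E4.ofTimeSpace t y) = V (Literature.Geometry.Lorentzian.E4.ofTimeSpace 0 y)) ∧ ∀ x ∈ B.domain, B.bilin x (V x) (V x) < 0 ∧ 0 < V x 0; let IsNr : Literature.Geometry.Lorentzian.ModelBackground → (Literature.Geometry.Lorentzian.E4 → Literature.Geometry.Lorentzian.E4) → ℝ → Prop := fun B V ρ ↦ IsSt B V ρ ∧ ContDiffOn ℝ ((⊤ : ℕ∞) : WithTop ℕ∞) B.bilin (B.domain : Set Literature.Geometry.Lorentzian.E4) ∧ ∃ M a : ℝ, 0 < M ∧ 10 * |a| ≤ 9 * M ∧ ρ = Literature.Geometry.Lorentzian.Kerr.rPlus M a - M / 4 ∧ (∀ x, B.radius x = Literature.Geometry.Lorentzian.Kerr.radius a x) ∧ ∀ m ≤ 10, ∀ x ∈ (B.domain : Set Literature.Geometry.Lorentzian.E4), ‖iteratedFDeriv ℝ m (fun y ↦ B.bilin y - Literature.Geometry.Lorentzian.Kerr.bilin M a y) x‖ * Literature.Geometry.Lorentzian.Kerr.radius a x ^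 (m + 1) ≤ M / 10 ^ 6; let IsSc : Literature.Geometry.Lorentzian.ModelBackground → (Literature.Geometry.Lorentzian.E4 → Literature.Geometry.Lorentzian.E4) → ℝ → Prop := fun B V ρ ↦ IsSt B V ρ ∧ 0 ≤ ρ ∧ (∀ x, B.radius x = Literature.Geometry.Lorentzian.Kerr.radius 0 x) ∧ ContDiffOn ℝ ((⊤ : ℕ∞) : WithTop ℕ∞) B.bilin (B.domain : Set Literature.Geometry.Lorentzian.E4) ∧ (∀ x ∈ (B.domain : Set Literature.Geometry.Lorentzian.E4), (∀ u : Literature.Geometry.Lorentzian.E4, u ≠ 0 → u 0 = 0 → 0 < B.bilin x u u) ∧ ∀ u v w : Literature.Geometry.Lorentzian.E4, B.bilin x (Literature.Geometry.Lorentzian.E4.basisVector 0) u * (fderiv ℝ B.bilin x v (Literature.Geometry.Lorentzian.E4.basisVector 0) w - fderiv ℝ B.bilin x w (Literature.Geometry.Lorentzian.E4.basisVector 0) v) + B.bilin x (Literature.Geometry.Lorentzian.E4.basisVector 0) v * (fderiv ℝ B.bilin x w (Literature.Geometry.Lorentzian.E4.basisVector 0) u - fderiv ℝ B.bilin x u (Literature.Geometry.Lorentzian.E4.basisVector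 0) w) + B.bilin x (Literature.Geometry.Lorentzian.E4.basisVector 0) w * (fderiv ℝ B.bilin x u (Literature.Geometry.Lorentzian.E4.basisVector 0) v - fderiv ℝ B.bilin x v (Literature.Geometry.Lorentzian.E4.basisVector 0) u) = 0) ∧ (∃ R₀ : ℝ, ∀ x ∈ (B.domain : Set Literature.Geometry.Lorentzian.E4), R₀ < B.radius x → B.bilin x (Literature.Geometry.Lorentzian.E4.basisVector 0) (Literature.Geometry.Lorentzian.E4.basisVector 0) < 0) ∧ ∃ ρH : ℝ, ρ < ρH ∧ ∀ x ∈ (B.domain : Set Literature.Geometry.Lorentzian.E4), B.radius x ≤ ρH → ∀ u : Literature.Geometry.Lorentzian.E4, B.bilin x u u ≤ 0 → B.bilin x u (V x) < 0 → x 1 * u 1 + x 2 * u 2 + x 3 * u 3 ≤ 0; let IsTb : Literature.Geometry.Lorentzian.ModelBackground → (Literature.Geometry.Lorentzian.E4 → Literature.Geometry.Lorentzian.E4) → ℝ → Prop := fun B V ρH ↦ ∀ x ∈ (B.domain : Set Literature.Geometry.Lorentzian.E4), B.radius x < ρH → ∀ u : Literature.Geometry.Lorentzian.E4, u ≠ 0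 → B.bilin x u u ≤ 0 → B.bilin x u (V x) < 0 → fderiv ℝ B.radius x u < 0; let IsHc : Literature.Geometry.Lorentzian.ModelBackground → (Literature.Geometry.Lorentzian.E4 → Literature.Geometry.Lorentzian.E4) → ℝ → Prop := fun B V ρ ↦ IsSt B V ρ ∧ 0 ≤ ρ ∧ (∃ a' : ℝ, ∀ x, B.radius x = Literature.Geometry.Lorentzian.Kerr.radius a' x) ∧ ContDiffOn ℝ ((⊤ : ℕ∞) : WithTop ℕ∞) B.bilin (B.domain : Set Literature.Geometry.Lorentzian.E4) ∧ (∀ x ∈ (B.domain : Set Literature.Geometry.Lorentzian.E4), ∀ u : Literature.Geometry.Lorentzian.E4, u ≠ 0 → u 0 = 0 → 0 < B.bilin x u u) ∧ (∃ R₀ c : ℝ, 0 < c ∧ ∀ x ∈ (B.domain : Set Literature.Geometry.Lorentzian.E4), R₀ < B.radius x → B.bilin x (Literature.Geometry.Lorentzian.E4.basisVector 0) (Literature.Geometry.Lorentzian.E4.basisVector 0) ≤ -c ∧ ∀ u : Literature.Geometry.Lorentzian.E4, u 0 = 0 → c * ‖u‖ ^ 2 ≤ B.bilin x u u) ∧ ∃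 ρH : ℝ, ρ < ρH ∧ IsTb B V ρH; let Jv : Literature.Geometry.Lorentzian.E4 → Literature.Geometry.Lorentzian.E4 := fun x ↦ x 1 • (Literature.Geometry.Lorentzian.E4.basisVector 2) - x 2 • (Literature.Geometry.Lorentzian.E4.basisVector 1); let IsAc : Literature.Geometry.Lorentzian.ModelBackground → (Literature.Geometry.Lorentzian.E4 → Literature.Geometry.Lorentzian.E4) → ℝ → Prop := fun B V ρ ↦ IsHc B V ρ ∧ (∀ x ∈ (B.domain : Set Literature.Geometry.Lorentzian.E4), ∀ v w : Literature.Geometry.Lorentzian.E4, fderiv ℝ B.bilin x (Jv x) v w + B.bilin x (Jv v) w + B.bilin x v (Jv w) = 0) ∧ ∃ ρH : ℝ, ρ < ρH ∧ IsTb B V ρH ∧ ∀ x ∈ (B.domain : Set Literature.Geometry.Lorentzian.E4), Jv x ≠ 0 → (ρH < B.radius x ↔ B.bilin x (Literature.Geometry.Lorentzian.E4.basisVector 0) (Literature.Geometry.Lorentzian.E4.basisVector 0) * B.bilin x (Jv x) (Jv x) - B.bilin x (Literature.Geometry.Lorentzian.E4.basisVector 0) (Jv x) ^ 2 < 0); let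 StC : (Literature.Geometry.Lorentzian.ModelBackground → (Literature.Geometry.Lorentzian.E4 → Literature.Geometry.Lorentzian.E4) → ℝ → Prop) → Literature.Geometry.Lorentzian.InitialDataSet (𝓡 3) X → Prop := fun C D ↦ ∀ 𝒟 : Literature.Geometry.Lorentzian.VacuumCauchyDevelopment D, 𝒟.IsMaximal → ∃ (O : Set 𝒟.carrier) (N : ℕ) (B : Fin N → Literature.Geometry.Lorentzian.ModelBackground) (V : Fin N → Literature.Geometry.Lorentzian.E4 → Literature.Geometry.Lorentzian.E4) (ρ : Fin N → ℝ) (motion : Fin N → Literature.Geometry.Lorentzian.lorentzGroup × Literature.Geometry.Lorentzian.E4) (d : Literature.Geometry.Lorentzian.FinalStateDecompositionOver 𝒟.toSpacetime O 2 (fun i ↦ (B i).boost (motion i).1 (motion i).2)), (∀ i, C (B i) (V i) (ρ i)) ∧ O = Summit.FinalStateConjecture.exteriorOf 𝒟.toCauchyDevelopment d.charted ∧ Summit.FinalStateConjecture.RaysStayInClosure 𝒟.toCauchyDevelopment O ∧ (∃ R : Fin N → ℝ → ℝ, (∀ i, Tendsto (R i) atTop atTop ∧ ∀ τ, ρ i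 + 1 ≤ R i τ) ∧ (∀ i, Tendsto (fun τ ↦ 𝒟.toSpacetime.truncDeviationCk ((B i).boost (motion i).1 (motion i).2) (d.chart i) 2 (R i τ) τ) atTop (𝓝 0)) ∧ ∀ τ₁ : ℝ, d.τ₀ < τ₁ → O \ d.certifiedLate R τ₁ ⊆ 𝒟.toSpacetime.metric.causalPast 𝒟.toSpacetime.timeOrientation (d.certifiedSlab R τ₁)) ∧ (∀ i, Summit.FinalStateConjecture.IsOrthochronous (motion i).1) ∧ (∀ i (ρ' : ℝ), ∀ᶠ τ in atTop, ∀ x ∈ ((B i).boost (motion i).1 (motion i).2).truncTimeSlab ρ' τ, 𝒟.toSpacetime.timeOrientation.IsFutureDirected (mfderiv 𝓘(ℝ, Literature.Geometry.Lorentzian.E4) (𝓡 4) (d.chart i) x (((motion i).1 : Literature.Geometry.Lorentzian.E4 ≃L[ℝ] Literature.Geometry.Lorentzian.E4) (V i (Literature.Geometry.Lorentzian.poincareInv (motion i).1 (motion i).2 (x : Literature.Geometry.Lorentzian.E4)))))) ∧ ∀ᶠ τ in atTop, ∀ x ∈ (Literature.Geometry.Lorentzian.Minkowski.backgroundOn d.flatDomain).timeSlab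 τ, 𝒟.toSpacetime.timeOrientation.IsFutureDirected (mfderiv 𝓘(ℝ, Literature.Geometry.Lorentzian.E4) (𝓡 4) d.flatChart x (Literature.Geometry.Lorentzian.E4.basisVector 0)); let StA := StC IsAc; let StS := StC IsSc; let StN := StC IsNr; let K : Literature.Geometry.Lorentzian.InitialDataSet (𝓡 3) X → Prop := fun D ↦ ∀ 𝒟 : Literature.Geometry.Lorentzian.VacuumCauchyDevelopment D, 𝒟.IsMaximal → ∃ (O : Set 𝒟.carrier) (d : Literature.Geometry.Lorentzian.FinalStateDecomposition 𝒟.toSpacetime O 2), (∀ i, Literature.Geometry.Lorentzian.Kerr.IsSubextremal (d.mass i) (d.spin i)) ∧ O = Summit.FinalStateConjecture.exteriorOf 𝒟.toCauchyDevelopment d.charted ∧ Summit.FinalStateConjecture.RaysStayInClosure 𝒟.toCauchyDevelopment O ∧ Summit.FinalStateConjecture.HasExhaustiveCharts d ∧ Summit.FinalStateConjecture.IsFutureOriented d; Literature.Geometry.Lorentzian.InitialDataSet.IsTameChristodoulouGeneric (Literature.Geometry.Lorentzian.admissibleVacuumData X) (fun D ↦ StA D → ¬ StS D → ¬ StN D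 → K D) 1

-- parent: NonStaticNoHair · glue (gen 1)
/--     item stmt-FinalStateConjecture-30062 · support · rank 205 · open
    parent: NonStaticNoHair · GLUE: children ⟹ parent · by planner
AxisymmetricNoHair → NonAxisymmetricNoHair → CollarlessNoHair → CollarJointExit → NonStaticNoHair -/
@[route_item "route-FinalStateConjecture-RootDecompAxisymmetricJunction"]
def NonStaticNoHairGlue : Prop :=
  AxisymmetricNoHair → NonAxisymmetricNoHair → CollarlessNoHair → CollarJointExit → NonStaticNoHair

/-- item stmt-FinalStateConjecture-25288 · crux · rank 3 · open · by planner
why it might fail: generic MGHDs need not settle in C² on exhaustive slabs: never-stationary end phases (perpetual N-body zoom-whirl, slowly decaying hair, weak-null-singular exteriors) of positive tame codimension-0 measure are not excluded beyond |a| ≪ M perturbations of Kerr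
sources: arXiv:1710.01722, arXiv:2104.11857, arXiv:2205.14808, arXiv:0904.0982, DafermosHolzegelRodnianskiTaylor2021
[crux] PIECE B1 of the split of GenericKerrSettling (stmt-FinalStateConjecture-17274) — GENERIC
ASYMPTOTIC STATIONARITY (dynamics wall): for every admissible carrier X,
tame-Christodoulou-generically in admissibleVacuumData X every maximal vacuum Cauchy development
settles, in the Statement's own C² chart currency (FinalStateDecompositionOver: common late time,
late hole charts + late flat chart into O, C² convergence on truncated slabs, separating tubes,
sublinear excision, covering clause; O = exteriorOf; RaysStayInClosure; exhaustive charts with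
radius floor ρ_i + 1 ≤ R_i → ∞ and causal-past covering; orthochronous motions; future-oriented
chart times via a stationary g₀-timelike field V with dt(V) > 0; flat radiation chart), to finitely
many boosted STATIONARY MODEL end-states (IsSt: reference data (U, g₀, t = x⁰, r) on E4 invariant
under x⁰-translation, U = {r > ρ}). No censorship conjunct, no Kerr, no
rigidity/vacuum/I⁺-regularity riders. [WEAKER: B ⟹ B1 kernel (SettledDev.stationary via
isStationaryModel_kerr: sub-extremal Kerr–Schild exteriors ARE stationary models); B1 ⟹ B is no-hair
without analyticity + generic third law, open] [leaf IDEA-NEEDED + INSTRUMENTABLE] [deps: -/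
@[route_item "route-FinalStateConjecture-RootDecompAxisymmetricJunction", crux]
def GenericAsymptoticStationarity : Prop :=
  ∀ (X : Type) [TopologicalSpace X] [ChartedSpace Literature.Geometry.Lorentzian.E3 X] [IsManifold (𝓡 3) ((⊤ : ℕ∞) : WithTop ℕ∞) X] [T2Space X] [SecondCountableTopology X] [ConnectedSpace X], let IsSt : Literature.Geometry.Lorentzian.ModelBackground → (Literature.Geometry.Lorentzian.E4 → Literature.Geometry.Lorentzian.E4) → ℝ → Prop := fun B V ρ ↦ (∀ x, B.time x = x 0) ∧ ((B.domain : Set Literature.Geometry.Lorentzian.E4) = {x | ρ < B.radius x}) ∧ (∀ (t : ℝ) (y : Literature.Geometry.Lorentzian.E3), B.radius (Literature.Geometry.Lorentzian.E4.ofTimeSpace t y) = B.radius (Literature.Geometry.Lorentzian.E4.ofTimeSpace 0 y)) ∧ (∀ (t : ℝ) (y : Literature.Geometry.Lorentzian.E3), B.bilin (Literature.Geometry.Lorentzian.E4.ofTimeSpace t y) = B.bilin (Literature.Geometry.Lorentzian.E4.ofTimeSpace 0 y)) ∧ (∀ (t : ℝ) (y : Literature.Geometry.Lorentzian.E3), V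 (Literature.Geometry.Lorentzian.E4.ofTimeSpace t y) = V (Literature.Geometry.Lorentzian.E4.ofTimeSpace 0 y)) ∧ ∀ x ∈ B.domain, B.bilin x (V x) (V x) < 0 ∧ 0 < V x 0; let St : Literature.Geometry.Lorentzian.InitialDataSet (𝓡 3) X → Prop := fun D ↦ ∀ 𝒟 : Literature.Geometry.Lorentzian.VacuumCauchyDevelopment D, 𝒟.IsMaximal → ∃ (O : Set 𝒟.carrier) (N : ℕ) (B : Fin N → Literature.Geometry.Lorentzian.ModelBackground) (V : Fin N → Literature.Geometry.Lorentzian.E4 → Literature.Geometry.Lorentzian.E4) (ρ : Fin N → ℝ) (motion : Fin N → Literature.Geometry.Lorentzian.lorentzGroup × Literature.Geometry.Lorentzian.E4) (d : Literature.Geometry.Lorentzian.FinalStateDecompositionOver 𝒟.toSpacetime O 2 (fun i ↦ (B i).boost (motion i).1 (motion i).2)), (∀ i, IsSt (B i) (V i) (ρ i)) ∧ O = Summit.FinalStateConjecture.exteriorOf 𝒟.toCauchyDevelopment d.charted ∧ Summit.FinalStateConjecture.RaysStayInClosure 𝒟.toCauchyDevelopment O ∧ (∃ R : Fin N → ℝ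 → ℝ, (∀ i, Tendsto (R i) atTop atTop ∧ ∀ τ, ρ i + 1 ≤ R i τ) ∧ (∀ i, Tendsto (fun τ ↦ 𝒟.toSpacetime.truncDeviationCk ((B i).boost (motion i).1 (motion i).2) (d.chart i) 2 (R i τ) τ) atTop (𝓝 0)) ∧ ∀ τ₁ : ℝ, d.τ₀ < τ₁ → O \ d.certifiedLate R τ₁ ⊆ 𝒟.toSpacetime.metric.causalPast 𝒟.toSpacetime.timeOrientation (d.certifiedSlab R τ₁)) ∧ (∀ i, Summit.FinalStateConjecture.IsOrthochronous (motion i).1) ∧ (∀ i (ρ' : ℝ), ∀ᶠ τ in atTop, ∀ x ∈ ((B i).boost (motion i).1 (motion i).2).truncTimeSlab ρ' τ, 𝒟.toSpacetime.timeOrientation.IsFutureDirected (mfderiv 𝓘(ℝ, Literature.Geometry.Lorentzian.E4) (𝓡 4) (d.chart i) x (((motion i).1 : Literature.Geometry.Lorentzian.E4 ≃L[ℝ] Literature.Geometry.Lorentzian.E4) (V i (Literature.Geometry.Lorentzian.poincareInv (motion i).1 (motion i).2 (x : Literature.Geometry.Lorentzian.E4)))))) ∧ ∀ᶠ τ in atTop,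 ∀ x ∈ (Literature.Geometry.Lorentzian.Minkowski.backgroundOn d.flatDomain).timeSlab τ, 𝒟.toSpacetime.timeOrientation.IsFutureDirected (mfderiv 𝓘(ℝ, Literature.Geometry.Lorentzian.E4) (𝓡 4) d.flatChart x (Literature.Geometry.Lorentzian.E4.basisVector 0)); Literature.Geometry.Lorentzian.InitialDataSet.IsTameChristodoulouGeneric (Literature.Geometry.Lorentzian.admissibleVacuumData X) St 1

/-- item stmt-FinalStateConjecture-17269 · crux · rank 4 · open · by planner
why it might fail: weak cosmic censorship in the smooth tame vacuum class is open: Christodoulou's instability theorem is BV scalar-field and does not descend (barrier Part 6); wDist-stable naked-singularity formation from admissible vacuum data (beyond the fine-tuned examples of arXiv:2204.09891) is not excluded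
sources: Christodoulou1999, arXiv:2204.09891, arXiv:2402.00062, arXiv:0811.0354, arXiv:1912.08478
[crux] (imported; re-typed successor of WeakCosmicCensorshipMGHD after the statement revision
p126844, re-type T2) TAME weak cosmic censorship in MGHD form: for every connected Hausdorff
second-countable smooth 3-manifold X, tame-Christodoulou-generically in admissibleVacuumData X
(IsTameChristodoulouGeneric … 1: the escaping one-parameter family lives on ONE fixed asymptotically
flat end, is jointly smooth, continuous at c = 0 in the Dafermos–Rodnianski weighted C²₋₁ × C¹₋₂
distance of that end, injective and immersed at c = 0) a maximal vacuum Cauchy development exists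
and every MGHD has complete future null infinity (sojourn form,
Summit.FinalStateConjecture.HasCompleteNullInfinity). This is the first conjunct-structure of the
RE-TYPED summit; NECESSARY (summit ⇒ it by IsTameChristodoulouGeneric.mono — Sketch.lean
tame_of_statement; landed as Theorems/PhaseMixingCaptureCaptureSufficesC2DiagonalReduction
tameCensorship_of_finalStateConjecture); it implies the pre-revision rank-5 item
WeakCosmicCensorshipMGHD (tame ⇒ plain genericity,
IsTameChristodoulouGeneric.isChristodoulouGeneric; landed as
weakCosmicCensorshipMGHD_of_tameCensorship), which stays in the file as a support / imp -/
@[route_item "route-FinalStateConjecture-RootDecompAxisymmetricJunction", crux]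
def WeakCosmicCensorship : Prop :=
  ∀ (X : Type) [TopologicalSpace X] [ChartedSpace Literature.Geometry.Lorentzian.E3 X] [IsManifold (𝓡 3) ((⊤ : ℕ∞) : WithTop ℕ∞) X] [T2Space X] [SecondCountableTopology X] [ConnectedSpace X], Literature.Geometry.Lorentzian.InitialDataSet.IsTameChristodoulouGeneric (Literature.Geometry.Lorentzian.admissibleVacuumData X) (fun D ↦ (∃ 𝒟 : Literature.Geometry.Lorentzian.VacuumCauchyDevelopment D, 𝒟.IsMaximal) ∧ ∀ 𝒟 : Literature.Geometry.Lorentzian.VacuumCauchyDevelopment D, 𝒟.IsMaximal → Summit.FinalStateConjecture.HasCompleteNullInfinity 𝒟.toCauchyDevelopment) 1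

/-- item stmt-FinalStateConjecture-28241 · crux · rank 5 · open · by planner
why it might fail: the typed tolerance (10⁻⁶ weighted C¹⁰, spin ≤ 0.9M, collar M/4) may exceed the effective smallness of every printed rigidity/stability theorem; AIK needs a bifurcate sphere a future-horizon model lacks; honest Kerr re-charting (exhaustive, future-oriented) is unported
sources: arXiv:0904.0982, arXiv:1501.01587, arXiv:2104.11857, arXiv:2205.14808, arXiv:gr-qc/9811021, arXiv:2606.28253
[crux · child NH₁ of B2 stmt-25289 · WEAKER · ATTACKABLE(porting) · UNDECIDED[effective ε at the
typed tuple] · does NOT count] PERTURBATIVE NO-HAIR: tame-Christodoulou-generically (codim ≥ 1 in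
admissibleVacuumData X, tame immersed curves), an admissible datum whose MGHDs settle — in the born
C² chart currency of St VERBATIM (late hole charts on boosted models, late flat chart, O =
exteriorOf, RaysStayInClosure, exhaustive radii Rᵢ → ∞ with floor ρᵢ + 1, causal-past covering,
orthochronous motions, future-directed model time) — to SLOW-NEAR-KERR COLLAR MODELS (IsNr = IsSt ∧
C^∞ reference form ∧ ∃ M > 0, |a| ≤ 0.9 M: model radius = Kerr–Schild r_a, inner radius ρ = r₊(M,a)
− M/4 (the chart domain straddles the hole's future event horizon), and scale-normalised weighted
C¹⁰ distance to the explicit ingoing Kerr–Schild form ≤ 10⁻⁶: ‖Dᵐ(g₀ − g_{M,a})(x)‖ · r_a(x)^{m+1} ≤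
10⁻⁶ M, m ≤ 10) settles to boosted sub-extremal Kerr exteriors (K, the Statement's settle clause).
RUNG: future-horizon perturbative rigidity of smooth stationary vacuum end-states
(Alexakis–Ionescu–Klainerman CMP 2010 = IK review Thm 3.15, all |a| < M, modulo the bifurcate-sphere
completion of a future-horizon-only m -/
@[route_item "route-FinalStateConjecture-RootDecompAxisymmetricJunction", crux]
def PerturbativeNoHair : Prop :=
  ∀ (X : Type) [TopologicalSpace X] [ChartedSpace Literature.Geometry.Lorentzian.E3 X] [IsManifold (𝓡 3) ((⊤ : ℕ∞) : WithTop ℕ∞) X] [T2Space X] [SecondCountableTopology X] [ConnectedSpace X], let IsSt : Literature.Geometry.Lorentzian.ModelBackground → (Literature.Geometry.Lorentzian.E4 → Literature.Geometry.Lorentzian.E4) → ℝ → Prop := fun B V ρ ↦ (∀ x, B.time x = x 0) ∧ ((B.domain : Set Literature.Geometry.Lorentzian.E4) = {x | ρ < B.radius x}) ∧ (∀ (t : ℝ) (y : Literature.Geometry.Lorentzian.E3), B.radius (Literature.Geometry.Lorentzian.E4.ofTimeSpace t y) = B.radius (Literature.Geometry.Lorentzian.E4.ofTimeSpace 0 y))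 ∧ (∀ (t : ℝ) (y : Literature.Geometry.Lorentzian.E3), B.bilin (Literature.Geometry.Lorentzian.E4.ofTimeSpace t y) = B.bilin (Literature.Geometry.Lorentzian.E4.ofTimeSpace 0 y)) ∧ (∀ (t : ℝ) (y : Literature.Geometry.Lorentzian.E3), V (Literature.Geometry.Lorentzian.E4.ofTimeSpace t y) = V (Literature.Geometry.Lorentzian.E4.ofTimeSpace 0 y)) ∧ ∀ x ∈ B.domain, B.bilin x (V x) (V x) < 0 ∧ 0 < V x 0; let IsNr : Literature.Geometry.Lorentzian.ModelBackground → (Literature.Geometry.Lorentzian.E4 → Literature.Geometry.Lorentzian.E4) → ℝ → Prop := fun B V ρ ↦ IsSt B V ρ ∧ ContDiffOn ℝ ((⊤ : ℕ∞) : WithTop ℕ∞) B.bilin (B.domain : Set Literature.Geometry.Lorentzian.E4) ∧ ∃ M a : ℝ, 0 < M ∧ 10 * |a| ≤ 9 * M ∧ ρ = Literature.Geometry.Lorentzian.Kerr.rPlus M a - M / 4 ∧ (∀ x, B.radius x = Literature.Geometry.Lorentzian.Kerr.radius a x) ∧ ∀ m ≤ 10, ∀ x ∈ (B.domain : Set Literature.Geometry.Lorentzian.E4),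 ‖iteratedFDeriv ℝ m (fun y ↦ B.bilin y - Literature.Geometry.Lorentzian.Kerr.bilin M a y) x‖ * Literature.Geometry.Lorentzian.Kerr.radius a x ^ (m + 1) ≤ M / 10 ^ 6; let StN : Literature.Geometry.Lorentzian.InitialDataSet (𝓡 3) X → Prop := fun D ↦ ∀ 𝒟 : Literature.Geometry.Lorentzian.VacuumCauchyDevelopment D, 𝒟.IsMaximal → ∃ (O : Set 𝒟.carrier) (N : ℕ) (B : Fin N → Literature.Geometry.Lorentzian.ModelBackground) (V : Fin N → Literature.Geometry.Lorentzian.E4 → Literature.Geometry.Lorentzian.E4) (ρ : Fin N → ℝ) (motion : Fin N → Literature.Geometry.Lorentzian.lorentzGroup × Literature.Geometry.Lorentzian.E4) (d : Literature.Geometry.Lorentzian.FinalStateDecompositionOver 𝒟.toSpacetime O 2 (fun i ↦ (B i).boost (motion i).1 (motion i).2)), (∀ i, IsNr (B i) (V i) (ρ i)) ∧ O = Summit.FinalStateConjecture.exteriorOf 𝒟.toCauchyDevelopment d.charted ∧ Summit.FinalStateConjecture.RaysStayInClosure 𝒟.toCauchyDevelopment O ∧ (∃ R : Fin N → ℝ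 → ℝ, (∀ i, Tendsto (R i) atTop atTop ∧ ∀ τ, ρ i + 1 ≤ R i τ) ∧ (∀ i, Tendsto (fun τ ↦ 𝒟.toSpacetime.truncDeviationCk ((B i).boost (motion i).1 (motion i).2) (d.chart i) 2 (R i τ) τ) atTop (𝓝 0)) ∧ ∀ τ₁ : ℝ, d.τ₀ < τ₁ → O \ d.certifiedLate R τ₁ ⊆ 𝒟.toSpacetime.metric.causalPast 𝒟.toSpacetime.timeOrientation (d.certifiedSlab R τ₁)) ∧ (∀ i, Summit.FinalStateConjecture.IsOrthochronous (motion i).1) ∧ (∀ i (ρ' : ℝ), ∀ᶠ τ in atTop, ∀ x ∈ ((B i).boost (motion i).1 (motion i).2).truncTimeSlab ρ' τ, 𝒟.toSpacetime.timeOrientation.IsFutureDirected (mfderiv 𝓘(ℝ, Literature.Geometry.Lorentzian.E4) (𝓡 4) (d.chart i) x (((motion i).1 : Literature.Geometry.Lorentzian.E4 ≃L[ℝ] Literature.Geometry.Lorentzian.E4) (V i (Literature.Geometry.Lorentzian.poincareInv (motion i).1 (motion i).2 (x : Literature.Geometry.Lorentzian.E4)))))) ∧ ∀ᶠ τ in atTop,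 ∀ x ∈ (Literature.Geometry.Lorentzian.Minkowski.backgroundOn d.flatDomain).timeSlab τ, 𝒟.toSpacetime.timeOrientation.IsFutureDirected (mfderiv 𝓘(ℝ, Literature.Geometry.Lorentzian.E4) (𝓡 4) d.flatChart x (Literature.Geometry.Lorentzian.E4.basisVector 0)); let K : Literature.Geometry.Lorentzian.InitialDataSet (𝓡 3) X → Prop := fun D ↦ ∀ 𝒟 : Literature.Geometry.Lorentzian.VacuumCauchyDevelopment D, 𝒟.IsMaximal → ∃ (O : Set 𝒟.carrier) (d : Literature.Geometry.Lorentzian.FinalStateDecomposition 𝒟.toSpacetime O 2), (∀ i, Literature.Geometry.Lorentzian.Kerr.IsSubextremal (d.mass i) (d.spin i)) ∧ O = Summit.FinalStateConjecture.exteriorOf 𝒟.toCauchyDevelopment d.charted ∧ Summit.FinalStateConjecture.RaysStayInClosure 𝒟.toCauchyDevelopment O ∧ Summit.FinalStateConjecture.HasExhaustiveCharts d ∧ Summit.FinalStateConjecture.IsFutureOriented d; Literature.Geometry.Lorentzian.InitialDataSet.IsTameChristodoulouGeneric (Literature.Geometry.Lorentzian.admissibleVacuumData X) (fun D ↦ StN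 D → K D) 1

/-- item stmt-FinalStateConjecture-29011 · crux · rank 6 · open · by planner
why it might fail: porting, not physics — first lemmas: D7 (AF of the static limit end: delivered by NO born clause) and D8 (print-faithful boundary-allowing transcription of static uniqueness, CCH 2012 Thm 3.1); then vacuum-of-limit, horizon/I⁺ causal theory, EH-normalised ingoing-KS re-charting (unported)
sources: arXiv:1004.0513, doi:10.1007/BF00759198, doi:10.1103/PhysRev.164.1776, arXiv:gr-qc/9809088, arXiv:gr-qc/0512116, arXiv:gr-qc/9311012
[crux · child S₁ of NH₂ stmt-28242 · critic A1 2026-08-30T06:02:56Z: rung = PRINT (CCH 2012 Thm 3.1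
/ CG 2010), tree transcription D8 + AF lemma D7 WANTED, NOT «by name» · WEAKER · ATTACKABLE(porting)
· EMPTY-BY-THEOREM modulo porting · ε-FREE · does NOT count] STATIC NO-HAIR:
tame-Christodoulou-generically (codim ≥ 1 in admissibleVacuumData X, tame immersed curves), an
admissible datum whose MGHDs settle — in the born C² chart currency of St VERBATIM (late hole charts
on boosted models, late flat chart, O = exteriorOf, RaysStayInClosure, exhaustive radii Rᵢ → ∞ with
floor ρᵢ + 1, causal-past covering, orthochronous motions, future-directed model time) — to SMOOTH
STATIC TRAPPED-COLLAR MODELS (IsSc = IsSt ∧ 0 ≤ ρ ∧ truncation radius = Euclidean |x⃗| ∧ C^∞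
reference form g₀ ∧ x⁰-slices g₀-spacelike ∧ the Killing field ∂₀ hypersurface-orthogonal in the
horizon-regular Frobenius form ξ♭∧dξ♭ = 0, ξ♭ = g₀(∂₀,·), coordinate derivatives ∧ ∂₀ timelike
outside some radius R₀ ∧ a trapped collar {r ≤ ρ_H}, ρ < ρ_H, on which every future causal vector
points weakly inwards — NO tolerance, NO Kerr parameter) but NOT to slow-near-Kerr collar models (¬
StN, born) settles to boosted sub-extremal K -/
@[route_item "route-FinalStateConjecture-RootDecompAxisymmetricJunction", crux]
def StaticNoHair : Prop :=
  ∀ (X : Type) [TopologicalSpace X] [ChartedSpace Literature.Geometry.Lorentzian.E3 X] [IsManifold (𝓡 3) ((⊤ : ℕ∞) : WithTop ℕ∞) X] [T2Space X] [SecondCountableTopology X] [ConnectedSpace X], let IsSt : Literature.Geometry.Lorentzian.ModelBackground → (Literature.Geometry.Lorentzian.E4 → Literature.Geometry.Lorentzian.E4) → ℝ → Prop := fun B V ρ ↦ (∀ x, B.time x = x 0) ∧ ((B.domain : Set Literature.Geometry.Lorentzian.E4) = {x | ρ < B.radius x}) ∧ (∀ (t : ℝ) (y : Literature.Geometry.Lorentzian.E3),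 B.radius (Literature.Geometry.Lorentzian.E4.ofTimeSpace t y) = B.radius (Literature.Geometry.Lorentzian.E4.ofTimeSpace 0 y)) ∧ (∀ (t : ℝ) (y : Literature.Geometry.Lorentzian.E3), B.bilin (Literature.Geometry.Lorentzian.E4.ofTimeSpace t y) = B.bilin (Literature.Geometry.Lorentzian.E4.ofTimeSpace 0 y)) ∧ (∀ (t : ℝ) (y : Literature.Geometry.Lorentzian.E3), V (Literature.Geometry.Lorentzian.E4.ofTimeSpace t y) = V (Literature.Geometry.Lorentzian.E4.ofTimeSpace 0 y)) ∧ ∀ x ∈ B.domain, B.bilin x (V x) (V x) < 0 ∧ 0 < V x 0; let IsNr : Literature.Geometry.Lorentzian.ModelBackground → (Literature.Geometry.Lorentzian.E4 → Literature.Geometry.Lorentzian.E4) → ℝ → Prop := fun B V ρ ↦ IsSt B V ρ ∧ ContDiffOn ℝ ((⊤ : ℕ∞) : WithTop ℕ∞) B.bilin (B.domain : Set Literature.Geometry.Lorentzian.E4) ∧ ∃ M a : ℝ, 0 < M ∧ 10 * |a| ≤ 9 * M ∧ ρ = Literature.Geometry.Lorentzian.Kerr.rPlus M a - M / 4 ∧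 (∀ x, B.radius x = Literature.Geometry.Lorentzian.Kerr.radius a x) ∧ ∀ m ≤ 10, ∀ x ∈ (B.domain : Set Literature.Geometry.Lorentzian.E4), ‖iteratedFDeriv ℝ m (fun y ↦ B.bilin y - Literature.Geometry.Lorentzian.Kerr.bilin M a y) x‖ * Literature.Geometry.Lorentzian.Kerr.radius a x ^ (m + 1) ≤ M / 10 ^ 6; let IsSc : Literature.Geometry.Lorentzian.ModelBackground → (Literature.Geometry.Lorentzian.E4 → Literature.Geometry.Lorentzian.E4) → ℝ → Prop := fun B V ρ ↦ IsSt B V ρ ∧ 0 ≤ ρ ∧ (∀ x, B.radius x = Literature.Geometry.Lorentzian.Kerr.radius 0 x) ∧ ContDiffOn ℝ ((⊤ : ℕ∞) : WithTop ℕ∞) B.bilin (B.domain : Set Literature.Geometry.Lorentzian.E4) ∧ (∀ x ∈ (B.domain : Set Literature.Geometry.Lorentzian.E4), (∀ u : Literature.Geometry.Lorentzian.E4, u ≠ 0 → u 0 = 0 → 0 < B.bilin x u u) ∧ ∀ u v w : Literature.Geometry.Lorentzian.E4, B.bilin x (Literature.Geometry.Lorentzian.E4.basisVector 0) u * (fderiv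 ℝ B.bilin x v (Literature.Geometry.Lorentzian.E4.basisVector 0) w - fderiv ℝ B.bilin x w (Literature.Geometry.Lorentzian.E4.basisVector 0) v) + B.bilin x (Literature.Geometry.Lorentzian.E4.basisVector 0) v * (fderiv ℝ B.bilin x w (Literature.Geometry.Lorentzian.E4.basisVector 0) u - fderiv ℝ B.bilin x u (Literature.Geometry.Lorentzian.E4.basisVector 0) w) + B.bilin x (Literature.Geometry.Lorentzian.E4.basisVector 0) w * (fderiv ℝ B.bilin x u (Literature.Geometry.Lorentzian.E4.basisVector 0) v - fderiv ℝ B.bilin x v (Literature.Geometry.Lorentzian.E4.basisVector 0) u) = 0) ∧ (∃ R₀ : ℝ, ∀ x ∈ (B.domain : Set Literature.Geometry.Lorentzian.E4), R₀ < B.radius x → B.bilin x (Literature.Geometry.Lorentzian.E4.basisVector 0) (Literature.Geometry.Lorentzian.E4.basisVector 0) < 0) ∧ ∃ ρH : ℝ, ρ < ρH ∧ ∀ x ∈ (B.domain : Set Literature.Geometry.Lorentzian.E4), B.radius x ≤ ρH → ∀ u : Literature.Geometry.Lorentzian.E4, B.bilin x u u ≤ 0 → B.bilin x u (V x) < 0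 → x 1 * u 1 + x 2 * u 2 + x 3 * u 3 ≤ 0; let StS : Literature.Geometry.Lorentzian.InitialDataSet (𝓡 3) X → Prop := fun D ↦ ∀ 𝒟 : Literature.Geometry.Lorentzian.VacuumCauchyDevelopment D, 𝒟.IsMaximal → ∃ (O : Set 𝒟.carrier) (N : ℕ) (B : Fin N → Literature.Geometry.Lorentzian.ModelBackground) (V : Fin N → Literature.Geometry.Lorentzian.E4 → Literature.Geometry.Lorentzian.E4) (ρ : Fin N → ℝ) (motion : Fin N → Literature.Geometry.Lorentzian.lorentzGroup × Literature.Geometry.Lorentzian.E4) (d : Literature.Geometry.Lorentzian.FinalStateDecompositionOver 𝒟.toSpacetime O 2 (fun i ↦ (B i).boost (motion i).1 (motion i).2)), (∀ i, IsSc (B i) (V i) (ρ i)) ∧ O = Summit.FinalStateConjecture.exteriorOf 𝒟.toCauchyDevelopment d.charted ∧ Summit.FinalStateConjecture.RaysStayInClosure 𝒟.toCauchyDevelopment O ∧ (∃ R : Fin N → ℝ → ℝ, (∀ i, Tendsto (R i) atTop atTop ∧ ∀ τ, ρ i + 1 ≤ R i τ) ∧ (∀ i, Tendsto (fun τ ↦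 𝒟.toSpacetime.truncDeviationCk ((B i).boost (motion i).1 (motion i).2) (d.chart i) 2 (R i τ) τ) atTop (𝓝 0)) ∧ ∀ τ₁ : ℝ, d.τ₀ < τ₁ → O \ d.certifiedLate R τ₁ ⊆ 𝒟.toSpacetime.metric.causalPast 𝒟.toSpacetime.timeOrientation (d.certifiedSlab R τ₁)) ∧ (∀ i, Summit.FinalStateConjecture.IsOrthochronous (motion i).1) ∧ (∀ i (ρ' : ℝ), ∀ᶠ τ in atTop, ∀ x ∈ ((B i).boost (motion i).1 (motion i).2).truncTimeSlab ρ' τ, 𝒟.toSpacetime.timeOrientation.IsFutureDirected (mfderiv 𝓘(ℝ, Literature.Geometry.Lorentzian.E4) (𝓡 4) (d.chart i) x (((motion i).1 : Literature.Geometry.Lorentzian.E4 ≃L[ℝ] Literature.Geometry.Lorentzian.E4) (V i (Literature.Geometry.Lorentzian.poincareInv (motion i).1 (motion i).2 (x : Literature.Geometry.Lorentzian.E4)))))) ∧ ∀ᶠ τ in atTop, ∀ x ∈ (Literature.Geometry.Lorentzian.Minkowski.backgroundOn d.flatDomain).timeSlab τ, 𝒟.toSpacetime.timeOrientation.IsFutureDirected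 (mfderiv 𝓘(ℝ, Literature.Geometry.Lorentzian.E4) (𝓡 4) d.flatChart x (Literature.Geometry.Lorentzian.E4.basisVector 0)); let StN : Literature.Geometry.Lorentzian.InitialDataSet (𝓡 3) X → Prop := fun D ↦ ∀ 𝒟 : Literature.Geometry.Lorentzian.VacuumCauchyDevelopment D, 𝒟.IsMaximal → ∃ (O : Set 𝒟.carrier) (N : ℕ) (B : Fin N → Literature.Geometry.Lorentzian.ModelBackground) (V : Fin N → Literature.Geometry.Lorentzian.E4 → Literature.Geometry.Lorentzian.E4) (ρ : Fin N → ℝ) (motion : Fin N → Literature.Geometry.Lorentzian.lorentzGroup × Literature.Geometry.Lorentzian.E4) (d : Literature.Geometry.Lorentzian.FinalStateDecompositionOver 𝒟.toSpacetime O 2 (fun i ↦ (B i).boost (motion i).1 (motion i).2)), (∀ i, IsNr (B i) (V i) (ρ i)) ∧ O = Summit.FinalStateConjecture.exteriorOf 𝒟.toCauchyDevelopment d.charted ∧ Summit.FinalStateConjecture.RaysStayInClosure 𝒟.toCauchyDevelopment O ∧ (∃ R : Fin N → ℝ → ℝ, (∀ i, Tendsto (R i) atTop atTop ∧ ∀ τ,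 ρ i + 1 ≤ R i τ) ∧ (∀ i, Tendsto (fun τ ↦ 𝒟.toSpacetime.truncDeviationCk ((B i).boost (motion i).1 (motion i).2) (d.chart i) 2 (R i τ) τ) atTop (𝓝 0)) ∧ ∀ τ₁ : ℝ, d.τ₀ < τ₁ → O \ d.certifiedLate R τ₁ ⊆ 𝒟.toSpacetime.metric.causalPast 𝒟.toSpacetime.timeOrientation (d.certifiedSlab R τ₁)) ∧ (∀ i, Summit.FinalStateConjecture.IsOrthochronous (motion i).1) ∧ (∀ i (ρ' : ℝ), ∀ᶠ τ in atTop, ∀ x ∈ ((B i).boost (motion i).1 (motion i).2).truncTimeSlab ρ' τ, 𝒟.toSpacetime.timeOrientation.IsFutureDirected (mfderiv 𝓘(ℝ, Literature.Geometry.Lorentzian.E4) (𝓡 4) (d.chart i) x (((motion i).1 : Literature.Geometry.Lorentzian.E4 ≃L[ℝ] Literature.Geometry.Lorentzian.E4) (V i (Literature.Geometry.Lorentzian.poincareInv (motion i).1 (motion i).2 (x : Literature.Geometry.Lorentzian.E4)))))) ∧ ∀ᶠ τ in atTop, ∀ x ∈ (Literature.Geometry.Lorentzian.Minkowski.backgroundOn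 d.flatDomain).timeSlab τ, 𝒟.toSpacetime.timeOrientation.IsFutureDirected (mfderiv 𝓘(ℝ, Literature.Geometry.Lorentzian.E4) (𝓡 4) d.flatChart x (Literature.Geometry.Lorentzian.E4.basisVector 0)); let K : Literature.Geometry.Lorentzian.InitialDataSet (𝓡 3) X → Prop := fun D ↦ ∀ 𝒟 : Literature.Geometry.Lorentzian.VacuumCauchyDevelopment D, 𝒟.IsMaximal → ∃ (O : Set 𝒟.carrier) (d : Literature.Geometry.Lorentzian.FinalStateDecomposition 𝒟.toSpacetime O 2), (∀ i, Literature.Geometry.Lorentzian.Kerr.IsSubextremal (d.mass i) (d.spin i)) ∧ O = Summit.FinalStateConjecture.exteriorOf 𝒟.toCauchyDevelopment d.charted ∧ Summit.FinalStateConjecture.RaysStayInClosure 𝒟.toCauchyDevelopment O ∧ Summit.FinalStateConjecture.HasExhaustiveCharts d ∧ Summit.FinalStateConjecture.IsFutureOriented d; Literature.Geometry.Lorentzian.InitialDataSet.IsTameChristodoulouGeneric (Literature.Geometry.Lorentzian.admissibleVacuumData X) (fun D ↦ StS D → ¬ StN D → K D) 1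

/-- item stmt-FinalStateConjecture-24565 · support · rank 9 · open · by planner
why it might fail: off the corner it needs the good clause to persist along the other clause's exit (asymptotic stability of settling / censoredness along tame curves at LARGE data, open); at a corner datum it needs a third exit; false for general predicate pairs (TameGenericityAndFails).
sources: arXiv:2104.08222, arXiv:2104.11857, Christodoulou1999
[crux] PIECE C — JointExit [WEAKER·thin — critic CLEARED 2026-08-30T01:37:00Z: «the ∧-tax isolated
as a piece; S ⟹ JointExit kernel (jointExit_of_finalStateConjecture)»; UNDECIDED[doors all open at
large data; stated test/rungs: r1 TameStableSettles at Kerr-close base data (KS21/GKS22 port), r2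
CornerExit under an explicit transversal-walls hypothesis]; leaf ATTACKABLE at rung level only]. for
every admissible X and every D ∈ admissibleVacuumData X failing the summit property: if (whenever
censoredness fails at D) there is a tame exit through D along which censoredness holds off the base
parameter, and (whenever settling fails at D) a tame exit along which settling holds, then there is
a tame exit through D along which the full summit property holds (a tame exit = one fixed end e, a
family F tame of order 1 at e, immersed at 0, F 0 = D, injective, all members admissible). Implied
by S (kernel `jointExit_of_finalStateConjecture`) and by each junction device on the summit (kernel,
draft file § doors). [difficulty: L] -/
@[route_item "route-FinalStateConjecture-RootDecompAxisymmetricJunction", crux]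
def JointExit : Prop :=
  ∀ (X : Type) [TopologicalSpace X] [ChartedSpace Literature.Geometry.Lorentzian.E3 X] [IsManifold (𝓡 3) ((⊤ : ℕ∞) : WithTop ℕ∞) X] [T2Space X] [SecondCountableTopology X] [ConnectedSpace X], ∀ D ∈ Literature.Geometry.Lorentzian.admissibleVacuumData X, ¬ ((∃ 𝒟 : Literature.Geometry.Lorentzian.VacuumCauchyDevelopment D, 𝒟.IsMaximal) ∧ ∀ 𝒟 : Literature.Geometry.Lorentzian.VacuumCauchyDevelopment D, 𝒟.IsMaximal → Summit.FinalStateConjecture.HasCompleteNullInfinity 𝒟.toCauchyDevelopment ∧ ∃ (O : Set 𝒟.carrier) (d : Literature.Geometry.Lorentzian.FinalStateDecomposition 𝒟.toSpacetime O 2), (∀ i, Literature.Geometry.Lorentzian.Kerr.IsSubextremal (d.mass i) (d.spin i)) ∧ O = Summit.FinalStateConjecture.exteriorOf 𝒟.toCauchyDevelopment d.charted ∧ Summit.FinalStateConjecture.RaysStayInClosure 𝒟.toCauchyDevelopment O ∧ Summit.FinalStateConjecture.HasExhaustiveCharts d ∧ Summit.FinalStateConjecture.IsFutureOriented d) → (¬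 ((∃ 𝒟 : Literature.Geometry.Lorentzian.VacuumCauchyDevelopment D, 𝒟.IsMaximal) ∧ ∀ 𝒟 : Literature.Geometry.Lorentzian.VacuumCauchyDevelopment D, 𝒟.IsMaximal → Summit.FinalStateConjecture.HasCompleteNullInfinity 𝒟.toCauchyDevelopment) → ∃ (e : Literature.Geometry.Lorentzian.AFEnd X) (F : EuclideanSpace ℝ (Fin 1) → Literature.Geometry.Lorentzian.InitialDataSet (𝓡 3) X), Literature.Geometry.Lorentzian.InitialDataSet.IsTameDataFamily e 1 F ∧ Literature.Geometry.Lorentzian.InitialDataSet.IsImmersedAtZero 1 F ∧ F 0 = D ∧ Function.Injective F ∧ (∀ c, F c ∈ Literature.Geometry.Lorentzian.admissibleVacuumData X) ∧ ∀ c ≠ 0, ((∃ 𝒟 : Literature.Geometry.Lorentzian.VacuumCauchyDevelopment (F c), 𝒟.IsMaximal) ∧ ∀ 𝒟 : Literature.Geometry.Lorentzian.VacuumCauchyDevelopment (F c), 𝒟.IsMaximal → Summit.FinalStateConjecture.HasCompleteNullInfinity 𝒟.toCauchyDevelopment)) → (¬ (∀ 𝒟 : Literature.Geometry.Lorentzian.VacuumCauchyDevelopment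 D, 𝒟.IsMaximal → ∃ (O : Set 𝒟.carrier) (d : Literature.Geometry.Lorentzian.FinalStateDecomposition 𝒟.toSpacetime O 2), (∀ i, Literature.Geometry.Lorentzian.Kerr.IsSubextremal (d.mass i) (d.spin i)) ∧ O = Summit.FinalStateConjecture.exteriorOf 𝒟.toCauchyDevelopment d.charted ∧ Summit.FinalStateConjecture.RaysStayInClosure 𝒟.toCauchyDevelopment O ∧ Summit.FinalStateConjecture.HasExhaustiveCharts d ∧ Summit.FinalStateConjecture.IsFutureOriented d) → ∃ (e : Literature.Geometry.Lorentzian.AFEnd X) (F : EuclideanSpace ℝ (Fin 1) → Literature.Geometry.Lorentzian.InitialDataSet (𝓡 3) X), Literature.Geometry.Lorentzian.InitialDataSet.IsTameDataFamily e 1 F ∧ Literature.Geometry.Lorentzian.InitialDataSet.IsImmersedAtZero 1 F ∧ F 0 = D ∧ Function.Injective F ∧ (∀ c, F c ∈ Literature.Geometry.Lorentzian.admissibleVacuumData X) ∧ ∀ c ≠ 0, (∀ 𝒟 : Literature.Geometry.Lorentzian.VacuumCauchyDevelopment (F c), 𝒟.IsMaximal → ∃ (O : Set 𝒟.carrier)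 (d : Literature.Geometry.Lorentzian.FinalStateDecomposition 𝒟.toSpacetime O 2), (∀ i, Literature.Geometry.Lorentzian.Kerr.IsSubextremal (d.mass i) (d.spin i)) ∧ O = Summit.FinalStateConjecture.exteriorOf 𝒟.toCauchyDevelopment d.charted ∧ Summit.FinalStateConjecture.RaysStayInClosure 𝒟.toCauchyDevelopment O ∧ Summit.FinalStateConjecture.HasExhaustiveCharts d ∧ Summit.FinalStateConjecture.IsFutureOriented d)) → ∃ (e : Literature.Geometry.Lorentzian.AFEnd X) (F : EuclideanSpace ℝ (Fin 1) → Literature.Geometry.Lorentzian.InitialDataSet (𝓡 3) X), Literature.Geometry.Lorentzian.InitialDataSet.IsTameDataFamily e 1 F ∧ Literature.Geometry.Lorentzian.InitialDataSet.IsImmersedAtZero 1 F ∧ F 0 = D ∧ Function.Injective F ∧ (∀ c, F c ∈ Literature.Geometry.Lorentzian.admissibleVacuumData X) ∧ ∀ c ≠ 0, ((∃ 𝒟 : Literature.Geometry.Lorentzian.VacuumCauchyDevelopment (F c), 𝒟.IsMaximal) ∧ ∀ 𝒟 : Literature.Geometry.Lorentzian.VacuumCauchyDevelopment (F c), 𝒟.IsMaximal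 → Summit.FinalStateConjecture.HasCompleteNullInfinity 𝒟.toCauchyDevelopment ∧ ∃ (O : Set 𝒟.carrier) (d : Literature.Geometry.Lorentzian.FinalStateDecomposition 𝒟.toSpacetime O 2), (∀ i, Literature.Geometry.Lorentzian.Kerr.IsSubextremal (d.mass i) (d.spin i)) ∧ O = Summit.FinalStateConjecture.exteriorOf 𝒟.toCauchyDevelopment d.charted ∧ Summit.FinalStateConjecture.RaysStayInClosure 𝒟.toCauchyDevelopment O ∧ Summit.FinalStateConjecture.HasExhaustiveCharts d ∧ Summit.FinalStateConjecture.IsFutureOriented d)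

/-- item stmt-FinalStateConjecture-25290 · support · rank 9 · open · by planner
why it might fail: at a datum where St holds but St → K fails, B2's exit curve carries data where St may FAIL (St is not tame-open), so K need not hold along it; joining needs tame openness of stationary settling or corner general position
sources: arXiv:2104.11857, arXiv:2205.14808, Christodoulou2008BlackHoles
[crux] PIECE B3 — STATIONARY JOINT EXIT (the ∧/→-tax of B1 ∧ B2 and nothing more): at every
admissible datum D not settling to sub-extremal Kerr (¬K D), a tame exit for stationary settling St
(handed over if St fails at D) and a tame exit for the no-hair implication St → K (handed over if it
fails at D) yield ONE tame exit (one end, tame order-1 immersed injective admissible family through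
D) along which K holds off 0. [WEAKER·thin: B ⟹ B3 kernel (B's own exit); implied by PointwiseNoHair
(door 2: along B1's exit stationary settling becomes Kerr settling) and by tame stability of Kerr
settling at no-hair-good settled data; UNDECIDED[doors]; leaf ATTACKABLE at rung level (near-Kerr:
Klainerman–Szeftel / GKS Cauchy stability read in the tame topology)] [deps:
GenericAsymptoticStationarity, GenericNoHair] [difficulty: L] Registered neighbour: the parent
route's JointExit (stmt-FinalStateConjecture-24565) is the same ∧-tax pattern one level up. -/
@[route_item "route-FinalStateConjecture-RootDecompAxisymmetricJunction", crux]
def StationaryJointExit : Prop :=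
  ∀ (X : Type) [TopologicalSpace X] [ChartedSpace Literature.Geometry.Lorentzian.E3 X] [IsManifold (𝓡 3) ((⊤ : ℕ∞) : WithTop ℕ∞) X] [T2Space X] [SecondCountableTopology X] [ConnectedSpace X], let IsSt : Literature.Geometry.Lorentzian.ModelBackground → (Literature.Geometry.Lorentzian.E4 → Literature.Geometry.Lorentzian.E4) → ℝ → Prop := fun B V ρ ↦ (∀ x, B.time x = x 0) ∧ ((B.domain : Set Literature.Geometry.Lorentzian.E4) = {x | ρ < B.radius x}) ∧ (∀ (t : ℝ) (y : Literature.Geometry.Lorentzian.E3), B.radius (Literature.Geometry.Lorentzian.E4.ofTimeSpace t y) = B.radius (Literature.Geometry.Lorentzian.E4.ofTimeSpace 0 y)) ∧ (∀ (t : ℝ) (y : Literature.Geometry.Lorentzian.E3), B.bilin (Literature.Geometry.Lorentzian.E4.ofTimeSpace t y) = B.bilin (Literature.Geometry.Lorentzian.E4.ofTimeSpace 0 y)) ∧ (∀ (t : ℝ) (y : Literature.Geometry.Lorentzian.E3), V (Literature.Geometry.Lorentzian.E4.ofTimeSpace t y) = V (Literature.Geometry.Lorentzian.E4.ofTimeSpace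 0 y)) ∧ ∀ x ∈ B.domain, B.bilin x (V x) (V x) < 0 ∧ 0 < V x 0; let St : Literature.Geometry.Lorentzian.InitialDataSet (𝓡 3) X → Prop := fun D ↦ ∀ 𝒟 : Literature.Geometry.Lorentzian.VacuumCauchyDevelopment D, 𝒟.IsMaximal → ∃ (O : Set 𝒟.carrier) (N : ℕ) (B : Fin N → Literature.Geometry.Lorentzian.ModelBackground) (V : Fin N → Literature.Geometry.Lorentzian.E4 → Literature.Geometry.Lorentzian.E4) (ρ : Fin N → ℝ) (motion : Fin N → Literature.Geometry.Lorentzian.lorentzGroup × Literature.Geometry.Lorentzian.E4) (d : Literature.Geometry.Lorentzian.FinalStateDecompositionOver 𝒟.toSpacetime O 2 (fun i ↦ (B i).boost (motion i).1 (motion i).2)), (∀ i, IsSt (B i) (V i) (ρ i)) ∧ O = Summit.FinalStateConjecture.exteriorOf 𝒟.toCauchyDevelopment d.charted ∧ Summit.FinalStateConjecture.RaysStayInClosure 𝒟.toCauchyDevelopment O ∧ (∃ R : Fin N → ℝ → ℝ, (∀ i, Tendsto (R i) atTop atTop ∧ ∀ τ, ρ i + 1 ≤ R i τ) ∧ (∀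 i, Tendsto (fun τ ↦ 𝒟.toSpacetime.truncDeviationCk ((B i).boost (motion i).1 (motion i).2) (d.chart i) 2 (R i τ) τ) atTop (𝓝 0)) ∧ ∀ τ₁ : ℝ, d.τ₀ < τ₁ → O \ d.certifiedLate R τ₁ ⊆ 𝒟.toSpacetime.metric.causalPast 𝒟.toSpacetime.timeOrientation (d.certifiedSlab R τ₁)) ∧ (∀ i, Summit.FinalStateConjecture.IsOrthochronous (motion i).1) ∧ (∀ i (ρ' : ℝ), ∀ᶠ τ in atTop, ∀ x ∈ ((B i).boost (motion i).1 (motion i).2).truncTimeSlab ρ' τ, 𝒟.toSpacetime.timeOrientation.IsFutureDirected (mfderiv 𝓘(ℝ, Literature.Geometry.Lorentzian.E4) (𝓡 4) (d.chart i) x (((motion i).1 : Literature.Geometry.Lorentzian.E4 ≃L[ℝ] Literature.Geometry.Lorentzian.E4) (V i (Literature.Geometry.Lorentzian.poincareInv (motion i).1 (motion i).2 (x : Literature.Geometry.Lorentzian.E4)))))) ∧ ∀ᶠ τ in atTop, ∀ x ∈ (Literature.Geometry.Lorentzian.Minkowski.backgroundOn d.flatDomain).timeSlab τ, 𝒟.toSpacetime.timeOrientation.IsFutureDirected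 (mfderiv 𝓘(ℝ, Literature.Geometry.Lorentzian.E4) (𝓡 4) d.flatChart x (Literature.Geometry.Lorentzian.E4.basisVector 0)); let K : Literature.Geometry.Lorentzian.InitialDataSet (𝓡 3) X → Prop := fun D ↦ ∀ 𝒟 : Literature.Geometry.Lorentzian.VacuumCauchyDevelopment D, 𝒟.IsMaximal → ∃ (O : Set 𝒟.carrier) (d : Literature.Geometry.Lorentzian.FinalStateDecomposition 𝒟.toSpacetime O 2), (∀ i, Literature.Geometry.Lorentzian.Kerr.IsSubextremal (d.mass i) (d.spin i)) ∧ O = Summit.FinalStateConjecture.exteriorOf 𝒟.toCauchyDevelopment d.charted ∧ Summit.FinalStateConjecture.RaysStayInClosure 𝒟.toCauchyDevelopment O ∧ Summit.FinalStateConjecture.HasExhaustiveCharts d ∧ Summit.FinalStateConjecture.IsFutureOriented d; let Exit : (Literature.Geometry.Lorentzian.InitialDataSet (𝓡 3) X → Prop) → Literature.Geometry.Lorentzian.InitialDataSet (𝓡 3) X → Prop := fun Q d ↦ ∃ (e : Literature.Geometry.Lorentzian.AFEnd X) (F : EuclideanSpace ℝ (Fin 1) → Literature.Geometry.Lorentzian.InitialDataSet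 (𝓡 3) X), Literature.Geometry.Lorentzian.InitialDataSet.IsTameDataFamily e 1 F ∧ Literature.Geometry.Lorentzian.InitialDataSet.IsImmersedAtZero 1 F ∧ F 0 = d ∧ Function.Injective F ∧ (∀ c, F c ∈ Literature.Geometry.Lorentzian.admissibleVacuumData X) ∧ ∀ c ≠ 0, Q (F c); ∀ D ∈ Literature.Geometry.Lorentzian.admissibleVacuumData X, ¬ K D → (¬ St D → Exit St D) → (¬ (St D → K D) → Exit (fun D ↦ St D → K D) D) → Exit K D

/-- item stmt-FinalStateConjecture-28243 · support · rank 9 · open · by planner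
why it might fail: at a datum where StN → K fails, NH₁'s exit curve carries data on which StN may FAIL while St holds with a far end state, where nothing forces K; joining needs tame openness of slow-near-Kerr settling (asymptotic stability of Kerr along tame curves) or corner general position
sources: arXiv:2104.11857, arXiv:2205.14808, Christodoulou2008BlackHoles
[crux · child NH₃ of B2 stmt-25289 · WEAKER · thin · ∧/→-tax · UNDECIDED[doors]] NO-HAIR JOINT EXIT
(the junction tax of NH₁ ∧ NH₂ and nothing more): at every admissible datum D where the no-hair
implication St D → K D fails, a tame exit for the perturbative implication StN → K (handed over if
it fails at D) and a tame exit for the global implication St → ¬StN → K (handed over if it fails at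
D) yield ONE tame exit (one end, tame order-1 immersed injective admissible curve through D) along
which St → K holds off 0. Vanishes under the ∀-data door PointwisePerturbativeNoHair (kernel
noHairJointExit_of_pointwise: then NH₂'s exit already serves); necessity 25289 ⟹ NH₃ (B2's own
exit). Dictionary node RigidityJunction (lens-3 g5). -/
@[route_item "route-FinalStateConjecture-RootDecompAxisymmetricJunction", crux]
def NoHairJointExit : Prop :=
  ∀ (X : Type) [TopologicalSpace X] [ChartedSpace Literature.Geometry.Lorentzian.E3 X] [IsManifold (𝓡 3) ((⊤ : ℕ∞) : WithTop ℕ∞) X] [T2Space X] [SecondCountableTopology X] [ConnectedSpace X], let IsSt : Literature.Geometry.Lorentzian.ModelBackground → (Literature.Geometry.Lorentzian.E4 → Literature.Geometry.Lorentzian.E4) → ℝ → Prop := fun B V ρ ↦ (∀ x, B.time x = x 0) ∧ ((B.domain : Set Literature.Geometry.Lorentzian.E4) = {x | ρ < B.radius x}) ∧ (∀ (t : ℝ) (y : Literature.Geometry.Lorentzian.E3), B.radius (Literature.Geometry.Lorentzian.E4.ofTimeSpace t y) = B.radius (Literature.Geometry.Lorentzian.E4.ofTimeSpace 0 y)) ∧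 (∀ (t : ℝ) (y : Literature.Geometry.Lorentzian.E3), B.bilin (Literature.Geometry.Lorentzian.E4.ofTimeSpace t y) = B.bilin (Literature.Geometry.Lorentzian.E4.ofTimeSpace 0 y)) ∧ (∀ (t : ℝ) (y : Literature.Geometry.Lorentzian.E3), V (Literature.Geometry.Lorentzian.E4.ofTimeSpace t y) = V (Literature.Geometry.Lorentzian.E4.ofTimeSpace 0 y)) ∧ ∀ x ∈ B.domain, B.bilin x (V x) (V x) < 0 ∧ 0 < V x 0; let IsNr : Literature.Geometry.Lorentzian.ModelBackground → (Literature.Geometry.Lorentzian.E4 → Literature.Geometry.Lorentzian.E4) → ℝ → Prop := fun B V ρ ↦ IsSt B V ρ ∧ ContDiffOn ℝ ((⊤ : ℕ∞) : WithTop ℕ∞) B.bilin (B.domain : Set Literature.Geometry.Lorentzian.E4) ∧ ∃ M a : ℝ, 0 < M ∧ 10 * |a| ≤ 9 * M ∧ ρ = Literature.Geometry.Lorentzian.Kerr.rPlus M a - M / 4 ∧ (∀ x, B.radius x = Literature.Geometry.Lorentzian.Kerr.radius a x) ∧ ∀ m ≤ 10, ∀ x ∈ (B.domain : Set Literature.Geometry.Lorentzian.E4),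 ‖iteratedFDeriv ℝ m (fun y ↦ B.bilin y - Literature.Geometry.Lorentzian.Kerr.bilin M a y) x‖ * Literature.Geometry.Lorentzian.Kerr.radius a x ^ (m + 1) ≤ M / 10 ^ 6; let St : Literature.Geometry.Lorentzian.InitialDataSet (𝓡 3) X → Prop := fun D ↦ ∀ 𝒟 : Literature.Geometry.Lorentzian.VacuumCauchyDevelopment D, 𝒟.IsMaximal → ∃ (O : Set 𝒟.carrier) (N : ℕ) (B : Fin N → Literature.Geometry.Lorentzian.ModelBackground) (V : Fin N → Literature.Geometry.Lorentzian.E4 → Literature.Geometry.Lorentzian.E4) (ρ : Fin N → ℝ) (motion : Fin N → Literature.Geometry.Lorentzian.lorentzGroup × Literature.Geometry.Lorentzian.E4) (d : Literature.Geometry.Lorentzian.FinalStateDecompositionOver 𝒟.toSpacetime O 2 (fun i ↦ (B i).boost (motion i).1 (motion i).2)), (∀ i, IsSt (B i) (V i) (ρ i)) ∧ O = Summit.FinalStateConjecture.exteriorOf 𝒟.toCauchyDevelopment d.charted ∧ Summit.FinalStateConjecture.RaysStayInClosure 𝒟.toCauchyDevelopment O ∧ (∃ R : Fin N → ℝ →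 ℝ, (∀ i, Tendsto (R i) atTop atTop ∧ ∀ τ, ρ i + 1 ≤ R i τ) ∧ (∀ i, Tendsto (fun τ ↦ 𝒟.toSpacetime.truncDeviationCk ((B i).boost (motion i).1 (motion i).2) (d.chart i) 2 (R i τ) τ) atTop (𝓝 0)) ∧ ∀ τ₁ : ℝ, d.τ₀ < τ₁ → O \ d.certifiedLate R τ₁ ⊆ 𝒟.toSpacetime.metric.causalPast 𝒟.toSpacetime.timeOrientation (d.certifiedSlab R τ₁)) ∧ (∀ i, Summit.FinalStateConjecture.IsOrthochronous (motion i).1) ∧ (∀ i (ρ' : ℝ), ∀ᶠ τ in atTop, ∀ x ∈ ((B i).boost (motion i).1 (motion i).2).truncTimeSlab ρ' τ, 𝒟.toSpacetime.timeOrientation.IsFutureDirected (mfderiv 𝓘(ℝ, Literature.Geometry.Lorentzian.E4) (𝓡 4) (d.chart i) x (((motion i).1 : Literature.Geometry.Lorentzian.E4 ≃L[ℝ] Literature.Geometry.Lorentzian.E4) (V i (Literature.Geometry.Lorentzian.poincareInv (motion i).1 (motion i).2 (x : Literature.Geometry.Lorentzian.E4)))))) ∧ ∀ᶠ τ in atTop,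 ∀ x ∈ (Literature.Geometry.Lorentzian.Minkowski.backgroundOn d.flatDomain).timeSlab τ, 𝒟.toSpacetime.timeOrientation.IsFutureDirected (mfderiv 𝓘(ℝ, Literature.Geometry.Lorentzian.E4) (𝓡 4) d.flatChart x (Literature.Geometry.Lorentzian.E4.basisVector 0)); let StN : Literature.Geometry.Lorentzian.InitialDataSet (𝓡 3) X → Prop := fun D ↦ ∀ 𝒟 : Literature.Geometry.Lorentzian.VacuumCauchyDevelopment D, 𝒟.IsMaximal → ∃ (O : Set 𝒟.carrier) (N : ℕ) (B : Fin N → Literature.Geometry.Lorentzian.ModelBackground) (V : Fin N → Literature.Geometry.Lorentzian.E4 → Literature.Geometry.Lorentzian.E4) (ρ : Fin N → ℝ) (motion : Fin N → Literature.Geometry.Lorentzian.lorentzGroup × Literature.Geometry.Lorentzian.E4) (d : Literature.Geometry.Lorentzian.FinalStateDecompositionOver 𝒟.toSpacetime O 2 (fun i ↦ (B i).boost (motion i).1 (motion i).2)), (∀ i, IsNr (B i) (V i) (ρ i)) ∧ O = Summit.FinalStateConjecture.exteriorOf 𝒟.toCauchyDevelopment d.charted ∧ Summit.FinalStateConjecture.RaysStayInClosure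 𝒟.toCauchyDevelopment O ∧ (∃ R : Fin N → ℝ → ℝ, (∀ i, Tendsto (R i) atTop atTop ∧ ∀ τ, ρ i + 1 ≤ R i τ) ∧ (∀ i, Tendsto (fun τ ↦ 𝒟.toSpacetime.truncDeviationCk ((B i).boost (motion i).1 (motion i).2) (d.chart i) 2 (R i τ) τ) atTop (𝓝 0)) ∧ ∀ τ₁ : ℝ, d.τ₀ < τ₁ → O \ d.certifiedLate R τ₁ ⊆ 𝒟.toSpacetime.metric.causalPast 𝒟.toSpacetime.timeOrientation (d.certifiedSlab R τ₁)) ∧ (∀ i, Summit.FinalStateConjecture.IsOrthochronous (motion i).1) ∧ (∀ i (ρ' : ℝ), ∀ᶠ τ in atTop, ∀ x ∈ ((B i).boost (motion i).1 (motion i).2).truncTimeSlab ρ' τ, 𝒟.toSpacetime.timeOrientation.IsFutureDirected (mfderiv 𝓘(ℝ, Literature.Geometry.Lorentzian.E4) (𝓡 4) (d.chart i) x (((motion i).1 : Literature.Geometry.Lorentzian.E4 ≃L[ℝ] Literature.Geometry.Lorentzian.E4) (V i (Literature.Geometry.Lorentzian.poincareInv (motion i).1 (motion i).2 (x : Literature.Geometry.Lorentzian.E4))))))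 ∧ ∀ᶠ τ in atTop, ∀ x ∈ (Literature.Geometry.Lorentzian.Minkowski.backgroundOn d.flatDomain).timeSlab τ, 𝒟.toSpacetime.timeOrientation.IsFutureDirected (mfderiv 𝓘(ℝ, Literature.Geometry.Lorentzian.E4) (𝓡 4) d.flatChart x (Literature.Geometry.Lorentzian.E4.basisVector 0)); let K : Literature.Geometry.Lorentzian.InitialDataSet (𝓡 3) X → Prop := fun D ↦ ∀ 𝒟 : Literature.Geometry.Lorentzian.VacuumCauchyDevelopment D, 𝒟.IsMaximal → ∃ (O : Set 𝒟.carrier) (d : Literature.Geometry.Lorentzian.FinalStateDecomposition 𝒟.toSpacetime O 2), (∀ i, Literature.Geometry.Lorentzian.Kerr.IsSubextremal (d.mass i) (d.spin i)) ∧ O = Summit.FinalStateConjecture.exteriorOf 𝒟.toCauchyDevelopment d.charted ∧ Summit.FinalStateConjecture.RaysStayInClosure 𝒟.toCauchyDevelopment O ∧ Summit.FinalStateConjecture.HasExhaustiveCharts d ∧ Summit.FinalStateConjecture.IsFutureOriented d; let Exit : (Literature.Geometry.Lorentzian.InitialDataSet (𝓡 3) X → Prop) → Literature.Geometry.Lorentzian.InitialDataSet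 (𝓡 3) X → Prop := fun Q d ↦ ∃ (e : Literature.Geometry.Lorentzian.AFEnd X) (F : EuclideanSpace ℝ (Fin 1) → Literature.Geometry.Lorentzian.InitialDataSet (𝓡 3) X), Literature.Geometry.Lorentzian.InitialDataSet.IsTameDataFamily e 1 F ∧ Literature.Geometry.Lorentzian.InitialDataSet.IsImmersedAtZero 1 F ∧ F 0 = d ∧ Function.Injective F ∧ (∀ c, F c ∈ Literature.Geometry.Lorentzian.admissibleVacuumData X) ∧ ∀ c ≠ 0, Q (F c); ∀ D ∈ Literature.Geometry.Lorentzian.admissibleVacuumData X, ¬ (St D → K D) → (¬ (StN D → K D) → Exit (fun D ↦ StN D → K D) D) → (¬ (St D → ¬ StN D → K D) → Exit (fun D ↦ St D → ¬ StN D → K D) D) → Exit (fun D ↦ St D → K D) D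

/-- item stmt-FinalStateConjecture-29013 · support · rank 9 · open · by planner
why it might fail: at a datum where St → ¬StS → ¬StN → K fails, S₂'s exit carries data that may settle to a STATIC non-near-Kerr presentation where nothing typed forces K until static uniqueness is ported; joining needs the door PointwiseStaticNoHair or corner general position
sources: arXiv:1004.0513, arXiv:2104.11857, Christodoulou2008BlackHoles
[crux · child S₃ of NH₂ stmt-28242 · WEAKER · thin · ∧/→-tax · UNDECIDED[doors]] STATIC JOINT EXIT
(the junction tax of S₁ ∧ S₂ and nothing more): at every admissible datum D where the global
implication St D → ¬StN D → K D fails, a tame exit for the static implication StS → ¬StN → K (handed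
over if it fails at D) and a tame exit for the non-static implication St → ¬StS → ¬StN → K (handed
over if it fails at D) yield ONE tame exit (one end, tame order-1 immersed injective admissible
curve through D) along which St → ¬StN → K holds off 0. Vanishes under the ∀-data door
PointwiseStaticNoHair (kernel staticJointExit_of_door: then S₂'s exit already serves); necessity NH₂
⟹ S₃ (NH₂'s own exit). Dictionary node StaticJunction (lens-3 g6). -/
@[route_item "route-FinalStateConjecture-RootDecompAxisymmetricJunction", crux]
def StaticJointExit : Prop :=
  ∀ (X : Type) [TopologicalSpace X] [ChartedSpace Literature.Geometry.Lorentzian.E3 X] [IsManifold (𝓡 3) ((⊤ : ℕ∞) : WithTop ℕ∞) X] [T2Space X] [SecondCountableTopology X] [ConnectedSpace X], let IsSt : Literature.Geometry.Lorentzian.ModelBackground → (Literature.Geometry.Lorentzian.E4 → Literature.Geometry.Lorentzian.E4) → ℝ → Prop := fun B V ρ ↦ (∀ x, B.time x = x 0) ∧ ((B.domain : Set Literature.Geometry.Lorentzian.E4) = {x | ρ < B.radius x}) ∧ (∀ (t : ℝ) (y : Literature.Geometry.Lorentzian.E3), B.radius (Literature.Geometry.Lorentzian.E4.ofTimeSpace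 t y) = B.radius (Literature.Geometry.Lorentzian.E4.ofTimeSpace 0 y)) ∧ (∀ (t : ℝ) (y : Literature.Geometry.Lorentzian.E3), B.bilin (Literature.Geometry.Lorentzian.E4.ofTimeSpace t y) = B.bilin (Literature.Geometry.Lorentzian.E4.ofTimeSpace 0 y)) ∧ (∀ (t : ℝ) (y : Literature.Geometry.Lorentzian.E3), V (Literature.Geometry.Lorentzian.E4.ofTimeSpace t y) = V (Literature.Geometry.Lorentzian.E4.ofTimeSpace 0 y)) ∧ ∀ x ∈ B.domain, B.bilin x (V x) (V x) < 0 ∧ 0 < V x 0; let IsNr : Literature.Geometry.Lorentzian.ModelBackground → (Literature.Geometry.Lorentzian.E4 → Literature.Geometry.Lorentzian.E4) → ℝ → Prop := fun B V ρ ↦ IsSt B V ρ ∧ ContDiffOn ℝ ((⊤ : ℕ∞) : WithTop ℕ∞) B.bilin (B.domain : Set Literature.Geometry.Lorentzian.E4) ∧ ∃ M a : ℝ, 0 < M ∧ 10 * |a| ≤ 9 * M ∧ ρ = Literature.Geometry.Lorentzian.Kerr.rPlus M a - M / 4 ∧ (∀ x, B.radius x = Literature.Geometry.Lorentzian.Kerr.radius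 a x) ∧ ∀ m ≤ 10, ∀ x ∈ (B.domain : Set Literature.Geometry.Lorentzian.E4), ‖iteratedFDeriv ℝ m (fun y ↦ B.bilin y - Literature.Geometry.Lorentzian.Kerr.bilin M a y) x‖ * Literature.Geometry.Lorentzian.Kerr.radius a x ^ (m + 1) ≤ M / 10 ^ 6; let IsSc : Literature.Geometry.Lorentzian.ModelBackground → (Literature.Geometry.Lorentzian.E4 → Literature.Geometry.Lorentzian.E4) → ℝ → Prop := fun B V ρ ↦ IsSt B V ρ ∧ 0 ≤ ρ ∧ (∀ x, B.radius x = Literature.Geometry.Lorentzian.Kerr.radius 0 x) ∧ ContDiffOn ℝ ((⊤ : ℕ∞) : WithTop ℕ∞) B.bilin (B.domain : Set Literature.Geometry.Lorentzian.E4) ∧ (∀ x ∈ (B.domain : Set Literature.Geometry.Lorentzian.E4), (∀ u : Literature.Geometry.Lorentzian.E4, u ≠ 0 → u 0 = 0 → 0 < B.bilin x u u) ∧ ∀ u v w : Literature.Geometry.Lorentzian.E4, B.bilin x (Literature.Geometry.Lorentzian.E4.basisVector 0) u * (fderiv ℝ B.bilin x v (Literature.Geometry.Lorentzian.E4.basisVector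 0) w - fderiv ℝ B.bilin x w (Literature.Geometry.Lorentzian.E4.basisVector 0) v) + B.bilin x (Literature.Geometry.Lorentzian.E4.basisVector 0) v * (fderiv ℝ B.bilin x w (Literature.Geometry.Lorentzian.E4.basisVector 0) u - fderiv ℝ B.bilin x u (Literature.Geometry.Lorentzian.E4.basisVector 0) w) + B.bilin x (Literature.Geometry.Lorentzian.E4.basisVector 0) w * (fderiv ℝ B.bilin x u (Literature.Geometry.Lorentzian.E4.basisVector 0) v - fderiv ℝ B.bilin x v (Literature.Geometry.Lorentzian.E4.basisVector 0) u) = 0) ∧ (∃ R₀ : ℝ, ∀ x ∈ (B.domain : Set Literature.Geometry.Lorentzian.E4), R₀ < B.radius x → B.bilin x (Literature.Geometry.Lorentzian.E4.basisVector 0) (Literature.Geometry.Lorentzian.E4.basisVector 0) < 0) ∧ ∃ ρH : ℝ, ρ < ρH ∧ ∀ x ∈ (B.domain : Set Literature.Geometry.Lorentzian.E4), B.radius x ≤ ρH → ∀ u : Literature.Geometry.Lorentzian.E4, B.bilin x u u ≤ 0 → B.bilin x u (V x) < 0 → x 1 * u 1 + x 2 * u 2 + x 3 * u 3 ≤ 0;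 let St : Literature.Geometry.Lorentzian.InitialDataSet (𝓡 3) X → Prop := fun D ↦ ∀ 𝒟 : Literature.Geometry.Lorentzian.VacuumCauchyDevelopment D, 𝒟.IsMaximal → ∃ (O : Set 𝒟.carrier) (N : ℕ) (B : Fin N → Literature.Geometry.Lorentzian.ModelBackground) (V : Fin N → Literature.Geometry.Lorentzian.E4 → Literature.Geometry.Lorentzian.E4) (ρ : Fin N → ℝ) (motion : Fin N → Literature.Geometry.Lorentzian.lorentzGroup × Literature.Geometry.Lorentzian.E4) (d : Literature.Geometry.Lorentzian.FinalStateDecompositionOver 𝒟.toSpacetime O 2 (fun i ↦ (B i).boost (motion i).1 (motion i).2)), (∀ i, IsSt (B i) (V i) (ρ i)) ∧ O = Summit.FinalStateConjecture.exteriorOf 𝒟.toCauchyDevelopment d.charted ∧ Summit.FinalStateConjecture.RaysStayInClosure 𝒟.toCauchyDevelopment O ∧ (∃ R : Fin N → ℝ → ℝ, (∀ i, Tendsto (R i) atTop atTop ∧ ∀ τ, ρ i + 1 ≤ R i τ) ∧ (∀ i, Tendsto (fun τ ↦ 𝒟.toSpacetime.truncDeviationCk ((B i).boost (motion i).1 (motion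 i).2) (d.chart i) 2 (R i τ) τ) atTop (𝓝 0)) ∧ ∀ τ₁ : ℝ, d.τ₀ < τ₁ → O \ d.certifiedLate R τ₁ ⊆ 𝒟.toSpacetime.metric.causalPast 𝒟.toSpacetime.timeOrientation (d.certifiedSlab R τ₁)) ∧ (∀ i, Summit.FinalStateConjecture.IsOrthochronous (motion i).1) ∧ (∀ i (ρ' : ℝ), ∀ᶠ τ in atTop, ∀ x ∈ ((B i).boost (motion i).1 (motion i).2).truncTimeSlab ρ' τ, 𝒟.toSpacetime.timeOrientation.IsFutureDirected (mfderiv 𝓘(ℝ, Literature.Geometry.Lorentzian.E4) (𝓡 4) (d.chart i) x (((motion i).1 : Literature.Geometry.Lorentzian.E4 ≃L[ℝ] Literature.Geometry.Lorentzian.E4) (V i (Literature.Geometry.Lorentzian.poincareInv (motion i).1 (motion i).2 (x : Literature.Geometry.Lorentzian.E4)))))) ∧ ∀ᶠ τ in atTop, ∀ x ∈ (Literature.Geometry.Lorentzian.Minkowski.backgroundOn d.flatDomain).timeSlab τ, 𝒟.toSpacetime.timeOrientation.IsFutureDirected (mfderiv 𝓘(ℝ, Literature.Geometry.Lorentzian.E4)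 (𝓡 4) d.flatChart x (Literature.Geometry.Lorentzian.E4.basisVector 0)); let StS : Literature.Geometry.Lorentzian.InitialDataSet (𝓡 3) X → Prop := fun D ↦ ∀ 𝒟 : Literature.Geometry.Lorentzian.VacuumCauchyDevelopment D, 𝒟.IsMaximal → ∃ (O : Set 𝒟.carrier) (N : ℕ) (B : Fin N → Literature.Geometry.Lorentzian.ModelBackground) (V : Fin N → Literature.Geometry.Lorentzian.E4 → Literature.Geometry.Lorentzian.E4) (ρ : Fin N → ℝ) (motion : Fin N → Literature.Geometry.Lorentzian.lorentzGroup × Literature.Geometry.Lorentzian.E4) (d : Literature.Geometry.Lorentzian.FinalStateDecompositionOver 𝒟.toSpacetime O 2 (fun i ↦ (B i).boost (motion i).1 (motion i).2)), (∀ i, IsSc (B i) (V i) (ρ i)) ∧ O = Summit.FinalStateConjecture.exteriorOf 𝒟.toCauchyDevelopment d.charted ∧ Summit.FinalStateConjecture.RaysStayInClosure 𝒟.toCauchyDevelopment O ∧ (∃ R : Fin N → ℝ → ℝ, (∀ i, Tendsto (R i) atTop atTop ∧ ∀ τ, ρ i + 1 ≤ R i τ) ∧ (∀ i, Tendsto (fun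 τ ↦ 𝒟.toSpacetime.truncDeviationCk ((B i).boost (motion i).1 (motion i).2) (d.chart i) 2 (R i τ) τ) atTop (𝓝 0)) ∧ ∀ τ₁ : ℝ, d.τ₀ < τ₁ → O \ d.certifiedLate R τ₁ ⊆ 𝒟.toSpacetime.metric.causalPast 𝒟.toSpacetime.timeOrientation (d.certifiedSlab R τ₁)) ∧ (∀ i, Summit.FinalStateConjecture.IsOrthochronous (motion i).1) ∧ (∀ i (ρ' : ℝ), ∀ᶠ τ in atTop, ∀ x ∈ ((B i).boost (motion i).1 (motion i).2).truncTimeSlab ρ' τ, 𝒟.toSpacetime.timeOrientation.IsFutureDirected (mfderiv 𝓘(ℝ, Literature.Geometry.Lorentzian.E4) (𝓡 4) (d.chart i) x (((motion i).1 : Literature.Geometry.Lorentzian.E4 ≃L[ℝ] Literature.Geometry.Lorentzian.E4) (V i (Literature.Geometry.Lorentzian.poincareInv (motion i).1 (motion i).2 (x : Literature.Geometry.Lorentzian.E4)))))) ∧ ∀ᶠ τ in atTop, ∀ x ∈ (Literature.Geometry.Lorentzian.Minkowski.backgroundOn d.flatDomain).timeSlab τ, 𝒟.toSpacetime.timeOrientation.IsFutureDirected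 (mfderiv 𝓘(ℝ, Literature.Geometry.Lorentzian.E4) (𝓡 4) d.flatChart x (Literature.Geometry.Lorentzian.E4.basisVector 0)); let StN : Literature.Geometry.Lorentzian.InitialDataSet (𝓡 3) X → Prop := fun D ↦ ∀ 𝒟 : Literature.Geometry.Lorentzian.VacuumCauchyDevelopment D, 𝒟.IsMaximal → ∃ (O : Set 𝒟.carrier) (N : ℕ) (B : Fin N → Literature.Geometry.Lorentzian.ModelBackground) (V : Fin N → Literature.Geometry.Lorentzian.E4 → Literature.Geometry.Lorentzian.E4) (ρ : Fin N → ℝ) (motion : Fin N → Literature.Geometry.Lorentzian.lorentzGroup × Literature.Geometry.Lorentzian.E4) (d : Literature.Geometry.Lorentzian.FinalStateDecompositionOver 𝒟.toSpacetime O 2 (fun i ↦ (B i).boost (motion i).1 (motion i).2)), (∀ i, IsNr (B i) (V i) (ρ i)) ∧ O = Summit.FinalStateConjecture.exteriorOf 𝒟.toCauchyDevelopment d.charted ∧ Summit.FinalStateConjecture.RaysStayInClosure 𝒟.toCauchyDevelopment O ∧ (∃ R : Fin N → ℝ → ℝ, (∀ i, Tendsto (R i) atTop atTop ∧ ∀ τ,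 ρ i + 1 ≤ R i τ) ∧ (∀ i, Tendsto (fun τ ↦ 𝒟.toSpacetime.truncDeviationCk ((B i).boost (motion i).1 (motion i).2) (d.chart i) 2 (R i τ) τ) atTop (𝓝 0)) ∧ ∀ τ₁ : ℝ, d.τ₀ < τ₁ → O \ d.certifiedLate R τ₁ ⊆ 𝒟.toSpacetime.metric.causalPast 𝒟.toSpacetime.timeOrientation (d.certifiedSlab R τ₁)) ∧ (∀ i, Summit.FinalStateConjecture.IsOrthochronous (motion i).1) ∧ (∀ i (ρ' : ℝ), ∀ᶠ τ in atTop, ∀ x ∈ ((B i).boost (motion i).1 (motion i).2).truncTimeSlab ρ' τ, 𝒟.toSpacetime.timeOrientation.IsFutureDirected (mfderiv 𝓘(ℝ, Literature.Geometry.Lorentzian.E4) (𝓡 4) (d.chart i) x (((motion i).1 : Literature.Geometry.Lorentzian.E4 ≃L[ℝ] Literature.Geometry.Lorentzian.E4) (V i (Literature.Geometry.Lorentzian.poincareInv (motion i).1 (motion i).2 (x : Literature.Geometry.Lorentzian.E4)))))) ∧ ∀ᶠ τ in atTop, ∀ x ∈ (Literature.Geometry.Lorentzian.Minkowski.backgroundOn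 d.flatDomain).timeSlab τ, 𝒟.toSpacetime.timeOrientation.IsFutureDirected (mfderiv 𝓘(ℝ, Literature.Geometry.Lorentzian.E4) (𝓡 4) d.flatChart x (Literature.Geometry.Lorentzian.E4.basisVector 0)); let K : Literature.Geometry.Lorentzian.InitialDataSet (𝓡 3) X → Prop := fun D ↦ ∀ 𝒟 : Literature.Geometry.Lorentzian.VacuumCauchyDevelopment D, 𝒟.IsMaximal → ∃ (O : Set 𝒟.carrier) (d : Literature.Geometry.Lorentzian.FinalStateDecomposition 𝒟.toSpacetime O 2), (∀ i, Literature.Geometry.Lorentzian.Kerr.IsSubextremal (d.mass i) (d.spin i)) ∧ O = Summit.FinalStateConjecture.exteriorOf 𝒟.toCauchyDevelopment d.charted ∧ Summit.FinalStateConjecture.RaysStayInClosure 𝒟.toCauchyDevelopment O ∧ Summit.FinalStateConjecture.HasExhaustiveCharts d ∧ Summit.FinalStateConjecture.IsFutureOriented d; let Exit : (Literature.Geometry.Lorentzian.InitialDataSet (𝓡 3) X → Prop) → Literature.Geometry.Lorentzian.InitialDataSet (𝓡 3) X → Prop := fun Q d ↦ ∃ (e : Literature.Geometry.Lorentzian.AFEnd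 X) (F : EuclideanSpace ℝ (Fin 1) → Literature.Geometry.Lorentzian.InitialDataSet (𝓡 3) X), Literature.Geometry.Lorentzian.InitialDataSet.IsTameDataFamily e 1 F ∧ Literature.Geometry.Lorentzian.InitialDataSet.IsImmersedAtZero 1 F ∧ F 0 = d ∧ Function.Injective F ∧ (∀ c, F c ∈ Literature.Geometry.Lorentzian.admissibleVacuumData X) ∧ ∀ c ≠ 0, Q (F c); ∀ D ∈ Literature.Geometry.Lorentzian.admissibleVacuumData X, ¬ (St D → ¬ StN D → K D) → (¬ (StS D → ¬ StN D → K D) → Exit (fun D ↦ StS D → ¬ StN D → K D) D) → (¬ (St D → ¬ StS D → ¬ StN D → K D) → Exit (fun D ↦ St D → ¬ StS D → ¬ StN D → K D) D) → Exit (fun D ↦ St D → ¬ StN D → K D) D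

/-- item stmt-FinalStateConjecture-30034 · assembly · rank 1 · open · by planner
sources: arXiv:1205.6112
[assembly] NonStaticNoHair → GenericAsymptoticStationarity → WeakCosmicCensorship →
PerturbativeNoHair → StaticNoHair → StaticJointExit → NoHairJointExit → StationaryJointExit →
JointExit → the final state conjecture as typed (the nine leaves by signature jointly give the
summit; recorded implication, the deciding theorem is `closes`). -/
@[route_item "route-FinalStateConjecture-RootDecompAxisymmetricJunction"]
def Assembly : Prop :=
  NonStaticNoHair → GenericAsymptoticStationarity → WeakCosmicCensorship → PerturbativeNoHair → StaticNoHair → StaticJointExit → NoHairJointExit → StationaryJointExit → JointExit → FinalStateConjecture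

/-! D-0027 §2.1 — DECIDING THEOREM (planner-authored via `route open/edit --closes-file`; by planner-decomp-fsc-writer-1-g2-0 2026-08-30T07:15:18Z):
its hypotheses are this route's items and its conclusion the sub-problem Statement (glue_lint), and it elaborates with this file. -/

@[closes "route-FinalStateConjecture-RootDecompAxisymmetricJunction"] theorem closes (hA : WeakCosmicCensorship) (hB₁ : GenericAsymptoticStationarity) (hNH₁ : PerturbativeNoHair) (h₁ : StaticNoHair) (h₂ : NonStaticNoHair) (h₃ : StaticJointExit) (hNH₃ : NoHairJointExit) (hB₃ : StationaryJointExit) (hC : JointExit) : _root_.FinalStateConjecture := by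
  intro X _ _ _ _ _ _ D hD
  obtain ⟨hD𝓓, hP⟩ := hD
  -- a tame-generic property hands a tame exit through every admissible datum failing it
  have key : ∀ (Q : Literature.Geometry.Lorentzian.InitialDataSet (𝓡 3) X → Prop),
      Literature.Geometry.Lorentzian.InitialDataSet.IsTameChristodoulouGeneric
        (Literature.Geometry.Lorentzian.admissibleVacuumData X) Q 1 → ¬ Q D →
      ∃ (e : Literature.Geometry.Lorentzian.AFEnd X)
        (F : EuclideanSpace ℝ (Fin 1) → Literature.Geometry.Lorentzian.InitialDataSet (𝓡 3) X),
        Literature.Geometry.Lorentzian.InitialDataSet.IsTameDataFamily e 1 F ∧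
          Literature.Geometry.Lorentzian.InitialDataSet.IsImmersedAtZero 1 F ∧ F 0 = D ∧
            Function.Injective F ∧ (∀ c, F c ∈ Literature.Geometry.Lorentzian.admissibleVacuumData X) ∧
              ∀ c ≠ 0, Q (F c) := by
    intro Q hQ hnQ
    obtain ⟨e, F, hF, himm, h0, hinj, h𝓓, hE⟩ := hQ D ⟨hD𝓓, hnQ⟩
    refine ⟨e, F, hF, himm, h0, hinj, h𝓓, fun c hc ↦ ?_⟩
    have h' := hE c hc
    simp only [Set.mem_setOf_eq, not_and, not_not] at h'
    exact h' (h𝓓 c)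
  -- censorship exit from A; settling exit from the stationary junction B3 fed by B1 and by the no-hair
  -- junction NH₃ fed by NH₁ and by the STATIC junction S₃ (fed by S₁ and S₂) in place of NH₂; C joins them
  obtain ⟨e, F, hF, himm, h0, hinj, h𝓓, hgood⟩ := hC X D hD𝓓 hP (key _ (hA X))
    (fun hnK ↦ hB₃ X D hD𝓓 hnK (key _ (hB₁ X))
      (fun hnI ↦ hNH₃ X D hD𝓓 hnI (key _ (hNH₁ X))
        (fun hnG ↦ h₃ X D hD𝓓 hnG (key _ (h₁ X)) (key _ (h₂ X)))))
  exact ⟨e, F, hF, himm, h0, hinj, h𝓓, fun c hc hmem ↦ hmem.2 (hgood c hc)⟩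

end Summit.FinalStateConjecture.FinalStateConjecture.Theses.RootDecompAxisymmetricJunction
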